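import Literature.Geometry.Lorentzian.StationaryBlackHoleUniqueness
import Literature.Geometry.Lorentzian.AchronalBoundary
import Literature.Geometry.Lorentzian.CompleteStationaryVacuumFlatProofs
import Literature.Geometry.Lorentzian.KillingFlowIsometry
import Mathlib.Analysis.Normed.Module.Connected
import HarnessLib

/-!
# Uniqueness of `I⁺`-regular stationary vacuum black holes — proofs file

Companion (proofs-only) file of `Literature.Geometry.Lorentzian.StationaryBlackHoleUniqueness`,
which vendors Chruściel–Costa's Theorem 1.3 (*On uniqueness of stationary vacuum black holes*,
Astérisque 321 (2008) 195–265 = arXiv:0806.0016) as the named fact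
`ChruscielCosta2008_uniqueness`. The theorem itself is not proved in the tree: its printed proof
(loc. cit., §7) is a synthesis of Hawking–Hollands–Ishibashi–Wald rigidity (Thm. 4.13–4.14), the
Chruściel–Delay–Galloway–Howard regularity of horizons (Thm. 4.11), topological censorship
(Cor. 2.4–2.5), the structure and ergoset theorems for the orbit space (Thms. 4.6, 5.1 ff.),
Weinstein's existence and uniqueness theory for the singular harmonic-map problem (§6), the
Sudarsky–Wald staticity argument and the static (Israel–Bunting–Masood-ul-Alam) uniqueness theorem
with the rigid positive energy theorem (Thm. 1.4, §7.2), none of which is available as a theorem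
of the tree. This file collects the steps of that proof which *are* provable on the Lorentz
prelude, beginning with the opening step of the non-rotating case (§7.2), and continuing with the
causal-theoretic preliminaries of §2.2 and §3 on which §4 (cross-sections of `𝓔⁺`, structure of
`⟨⟨M_ext⟩⟩`) is built:

* §7.2, first sentence, with §2.3 (2.8): under `IsNonDegenerateHorizon` the horizon Killing field
  is null on `𝓔⁺` and obeys the surface-gravity formula pointwise
  (`StationaryAFBlackHole.exists_isNull_killing_of_isNonDegenerateHorizon`);
* §2.2, (2.1)–(2.6): the orbits of the stationary Killing field through `Σ_ext` are future
  timelike curves, so `M_ext ⊆ I⁺(M_ext) ∩ I⁻(M_ext) = ⟨⟨M_ext⟩⟩`, `I^±(⟨⟨M_ext⟩⟩) = I^±(M_ext)`,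
  `⟨⟨M_ext⟩⟩` is non-empty and chronologically convex, `∂⟨⟨M_ext⟩⟩ ⊆ 𝓗⁺ ∪ 𝓗⁻` ("the boundaries of
  `⟨⟨M_ext⟩⟩` are included in the event horizons"), and `𝓔⁺ ⊆ 𝓑 ∩ cl ⟨⟨M_ext⟩⟩` is **achronal**
  (a subset of the achronal boundary `𝓗⁺ = ∂I⁻(M_ext)`, Hawking–Ellis Prop. 6.3.1 as proved in
  `AchronalBoundary.lean`); `M_ext = ⋃ₜ φₜ(Σ_ext)` is invariant under the flow of the stationary
  Killing field, which has no zeros on it, while a zero of a Killing field is a (compact)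
  flow-invariant set (the remark before Cor. 3.8), and in an `I⁺`-regular black hole (strong
  causality on `⟨⟨M_ext⟩⟩`) the Killing orbits through `M_ext` are injective — the stationary
  `ℝ`-action on `M_ext` is free (§4.2: "the flow of `K₀` in `M_ext` is by time translations")
  (`StationaryAFBlackHole.Mext_subset_doc`, `….isAchronal_horizon`, `….Mext_invariant`,
  `….IsIPlusRegular.injective_of_isMIntegralCurve`, …;
  `𝓔⁺ ⊆ ∂⟨⟨M_ext⟩⟩`, `𝓔⁺ ⊆ cl ⟨⟨M_ext⟩⟩` for `StationaryAFBlackHole` and the causal convexity of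
  `⟨⟨M_ext⟩⟩` by push-up are in `StaticBlackHoleUniquenessProofs.lean`);
* §3, **Lemma 3.1**: for the hypersurface `S ⊇ Σ_ext` of Def. 1.1 (`IPlusRegularHypersurface`,
  acausal) and `p ∈ M_ext` there is a point `r = φ_{t₀}(p) ∈ Σ_ext` of the Killing orbit of `p`
  with `S̄ ∩ I⁺(r) = ∅`; in particular the boundary `∂S̄ ⊆ 𝓔⁺` does not meet `I⁺(r)`
  (`StationaryAFBlackHole.IPlusRegularHypersurface.exists_mem_far_closure_inter_chronologicalFuture_eq_empty`);
* §3, **Corollary 3.3**: the stationary Killing field has no zeros on `S̄` (hence none on `S` and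
  none on the cross-section `∂S̄ ⊆ 𝓔⁺`) — from Lemma 3.1 and the flow of `X₀` by
  time-orientation-preserving isometries (`Literature.Geometry.Lorentzian.KillingFlowIsometry`:
  a zero is a fixed point, and `φ₋ₜ(I⁺(p)) = I⁺(φ₋ₜ(p))`)
  (`StationaryAFBlackHole.IPlusRegularHypersurface.killing_ne_zero_of_mem_closure_carrierSet`),
  and `X₀` is tangent to `𝓔⁺` and to `⟨⟨M_ext⟩⟩` (`StationaryAFBlackHole.mem_horizon_of_isMIntegralCurve`);
* §3, the rest for `X₀` (case `s = 1`): the Killing orbit of a point of `M_ext` eventually enters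
  `I⁺(p)` for every `p ∈ M_ext` (the property behind "Lemma [LtorMext]", here from connectedness of
  `Σ_ext`), **Lemma 3.2 (1)** (a compact `S ⊆ I⁺(M_ext)`
  lies in one `I⁺(p)`), **Lemma 3.5** (orbits through `⟨⟨M_ext⟩⟩` are future-oriented),
  **Lemma 3.6** (`M_ext ⊆ I^∓(C)` for flow-invariant `C` meeting `I^±(M_ext)`), **Lemma 3.7** and
  **Corollary 3.8** (`X₀` has no zeros in a chronological — e.g. `I⁺`-regular — `⟨⟨M_ext⟩⟩`)
  (`StationaryAFBlackHole.exists_orbit_mem_chronologicalFuture`, `….killing_ne_zero_of_mem_doc`,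
  `….IsIPlusRegular.killing_ne_zero_of_mem_doc`); and the first step of §4.2, Thm. 4.5: every
  Killing orbit through `⟨⟨M_ext⟩⟩` meets `I⁻(Σ_ext)` and `I⁺(Σ_ext)`
  (`StationaryAFBlackHole.exists_apply_mem_chronologicalPast_image_far_of_mem_doc`).

## References

* P. T. Chruściel, J. L. Costa, *On uniqueness of stationary vacuum black holes*, Astérisque 321
  (2008) 195–265, arXiv:0806.0016, §2.2 ((2.1)–(2.6)), §2.3 ((2.8)–(2.10)), §3 (Lemmas 3.1,
  3.2, 3.4–3.7, Cor. 3.3, Cor. 3.8), §4.2, §7 (key `ChruscielCosta2008`).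
* S. W. Hawking, G. F. R. Ellis, *The large scale structure of space-time*, CUP 1973, §6.3,
  Prop. 6.3.1 (achronal boundaries) (key `HawkingEllis1973`).
* B. O'Neill, *Semi-Riemannian geometry*, Academic Press 1983, Ch. 9, Prop. 9.25 (Killing
  equation) (key `ONeillSemiRiemannian1983`).
-/

noncomputable section

open scoped Manifold ContDiff

universe u

namespace Literature.Geometry.Lorentzian

/-! ### A first step of the printed proof (§7.2): non-degeneracy makes the horizon Killing field null

Chruściel–Costa, proof of Theorem 1.3, §7.2 (p. 34 of arXiv:0806.0016): "By hypothesis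
`∇(g(X, X))` has no zeros on `𝓔⁺`, so all components of the future event horizon are
non-degenerate" — the surface gravity `κ` being *defined* on a Killing horizon by
`d(g(X, X))|_𝓝 = -2κ X♭` (§2.3, (2.8)). In the tree's rendering of the horizon hypothesis
(`Spacetime.IsNonDegenerateHorizon`: a Killing field `K`, nowhere zero on and tangent to `𝓔⁺`, with
`∇_K K = κ K` on `𝓔⁺` for one constant `κ ≠ 0`) the Killing equation
`g(∇_Y K, Z) + g(Y, ∇_Z K) = 0` alone yields, pointwise on `𝓔⁺`, the two identities on which the
module docstring's comparison with the printed "(mean) non-degenerate" rests: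

* `g(K, K) = 0` — `K` is a **null** Killing field on `𝓔⁺` (take `Y = Z = K`: `2κ g(K, K) = 0`);
* `g(∇_Y K, K) = -κ g(K, Y)` for every tangent vector `Y` — with metric compatibility
  `Y g(K, K) = 2 g(∇_Y K, K)` this is exactly (2.8), `d(g(K, K)) = -2κ K♭`, so the tree's constant
  `κ ≠ 0` is the printed surface gravity of `K` and `d(g(K, K))` has no zeros on `𝓔⁺`.

They are proved here for a general pseudo-Riemannian metric, then specialised to
`IsNonDegenerateHorizon` and to the hypotheses of `ChruscielCosta2008_uniqueness`. -/

namespace PseudoRiemannianMetric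

variable {E : Type*} [NormedAddCommGroup E] [NormedSpace ℝ E] {H : Type*} [TopologicalSpace H]
  {I : ModelWithCorners ℝ E H} {M : Type*} [TopologicalSpace M] [ChartedSpace H M]
  [IsManifold I ∞ M] {n : ℕ∞ω} {g : PseudoRiemannianMetric I n E (TangentSpace I : M → Type _)}
  [g.HasLeviCivita]

/-- For a Killing field `X` the endomorphism `∇X` is `g`-skew: `g(∇_Y X, Y) = 0` for every tangent
vector `Y` (the Killing equation with both slots equal to `Y`). O'Neill 1983, Ch. 9, Prop. 9.25;
Chruściel–Costa 2008, §2.3. [cite: ChruscielCosta2008, §2.3] -/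
theorem IsKillingField.val_leviCivita_apply_self {X : Π x : M, TangentSpace I x}
    (hX : g.IsKillingField X) (x : M) (Y₀ : TangentSpace I x) :
    g.val x (g.leviCivita X x Y₀) Y₀ = 0 := by
  have h := hX.val_leviCivita_add x Y₀ Y₀
  rw [g.symm x Y₀ (g.leviCivita X x Y₀)] at h
  linarith

/-- **A Killing field with non-zero surface gravity is null.** If `X` is a Killing field and
`∇_{X(x)} X = κ X(x)` with `κ ≠ 0`, then `g(X(x), X(x)) = 0`: indeed
`0 = g(∇_X X, X) = κ g(X, X)`. This is why the horizon Killing field of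
`Spacetime.IsNonDegenerateHorizon` is null on `𝓔⁺`. Chruściel–Costa 2008, §2.3 ((2.8): the surface
gravity is defined on the null set `𝓝(X) = {g(X, X) = 0, X ≠ 0}`) and §7.2. [cite: ChruscielCosta2008, §2.3 (2.8) and §7.2] -/
theorem IsKillingField.val_self_eq_zero_of_leviCivita_eq_smul {X : Π x : M, TangentSpace I x}
    (hX : g.IsKillingField X) {x : M} {κ : ℝ} (hκ : κ ≠ 0)
    (h : g.leviCivita X x (X x) = κ • X x) : g.val x (X x) (X x) = 0 := by
  have h0 := hX.val_leviCivita_apply_self x (X x)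
  have h1 : g.val x (κ • X x) (X x) = κ * g.val x (X x) (X x) := by simp
  rw [h, h1] at h0
  exact (mul_eq_zero.1 h0).resolve_left hκ

/-- **The surface-gravity formula, pointwise.** If `X` is a Killing field and
`∇_{X(x)} X = κ X(x)`, then `g(∇_Y X, X)(x) = -κ g(X(x), Y)` for every tangent vector `Y` at `x`
(Killing equation with `Z = X(x)`). Combined with metric compatibility,
`Y g(X, X) = 2 g(∇_Y X, X)`, this is Chruściel–Costa's definition (2.8) of the surface gravity,
`d(g(X, X)) = -2κ X♭`, read pointwise. Chruściel–Costa 2008, §2.3, (2.8). [cite: ChruscielCosta2008, §2.3 (2.8)] -/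
theorem IsKillingField.val_leviCivita_eq_neg_mul_of_leviCivita_eq_smul
    {X : Π x : M, TangentSpace I x} (hX : g.IsKillingField X) {x : M} {κ : ℝ}
    (h : g.leviCivita X x (X x) = κ • X x) (Y₀ : TangentSpace I x) :
    g.val x (g.leviCivita X x Y₀) (X x) = -(κ * g.val x (X x) Y₀) := by
  have h1 := hX.val_leviCivita_add x Y₀ (X x)
  rw [h, map_smul, smul_eq_mul, g.symm x Y₀ (X x)] at h1
  linarith

end PseudoRiemannianMetric

namespace LorentzianMetric

variable {E : Type*} [NormedAddCommGroup E] [NormedSpace ℝ E] {H : Type*} [TopologicalSpace H]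
  {I : ModelWithCorners ℝ E H} {M : Type*} [TopologicalSpace M] [ChartedSpace H M]
  [IsManifold I ∞ M] {n : ℕ∞ω} {g : LorentzianMetric I n M} [g.HasLeviCivita] {τ : TimeOrientation g}

/-- **A non-degenerate horizon carries a null Killing field of surface gravity `κ ≠ 0`.** If `𝓔⁺`
(relative to `Mext`) is a non-degenerate horizon in the sense of `IsNonDegenerateHorizon`, then its
Killing field `K` is, at every point `p ∈ 𝓔⁺`, **null** (`g(K, K) = 0`, `K ≠ 0`), satisfies
`∇_K K = κ K`, and obeys the surface-gravity formula `g(∇_Y K, K) = -κ g(K, Y)` for all `Y`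
(Chruściel–Costa's (2.8) pointwise), for one constant `κ ≠ 0`; and `𝓔⁺` is invariant under the
flow of `K`. This is the first sentence of Chruściel–Costa's §7.2 ("by hypothesis `∇(g(X, X))`
has no zeros on `𝓔⁺`, so all components of the future event horizon are non-degenerate") for the
tree's horizon hypothesis. Chruściel–Costa 2008, §2.3 (2.8)–(2.10) and §7.2. [cite: ChruscielCosta2008, §2.3 (2.8) and §7.2] -/
theorem IsNonDegenerateHorizon.exists_isNull {Mext : Set M}
    (h : g.IsNonDegenerateHorizon τ Mext) :
    ∃ K : Π x : M, TangentSpace I x, g.IsKillingField K ∧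
      (∀ γ : ℝ → M, IsMIntegralCurve γ K → γ 0 ∈ g.futureEventHorizonOfEnd τ Mext →
        ∀ t, γ t ∈ g.futureEventHorizonOfEnd τ Mext) ∧
      ∃ κ : ℝ, κ ≠ 0 ∧ ∀ p ∈ g.futureEventHorizonOfEnd τ Mext,
        g.IsNull (K p) ∧ g.leviCivita K p (K p) = κ • K p ∧
          ∀ Y₀ : TangentSpace I p,
            g.val p (g.leviCivita K p Y₀) (K p) = -(κ * g.val p (K p) Y₀) := by
  obtain ⟨K, hK, hne, htan, κ, hκ, hκK⟩ := h
  refine ⟨K, hK, htan, κ, hκ, fun p hp ↦ ⟨⟨?_, hne p hp⟩, hκK p hp, fun Y₀ ↦ ?_⟩⟩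
  · exact hK.val_self_eq_zero_of_leviCivita_eq_smul hκ (hκK p hp)
  · exact hK.val_leviCivita_eq_neg_mul_of_leviCivita_eq_smul (hκK p hp) Y₀

end LorentzianMetric

namespace StationaryAFBlackHole

variable {𝓑 : StationaryAFBlackHole.{u}}

/-- **Under the horizon hypothesis of Theorem 1.3 the event horizon carries a null Killing field
with non-zero surface gravity.** For a stationary AF black hole `𝓑` whose future event horizon
`𝓔⁺ = 𝓑.horizon` is non-degenerate (`IsNonDegenerateHorizon 𝓑.Mext`, the last hypothesis of
`ChruscielCosta2008_uniqueness`), there are a Killing field `K` of `𝓑.metric`, leaving `𝓔⁺`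
invariant, and a constant `κ ≠ 0` such that at every `p ∈ 𝓔⁺`: `K(p)` is null, `∇_K K = κ K`, and
`g(∇_Y K, K) = -κ g(K, Y)` for all `Y` — so `d(g(K, K)) = -2κ K♭ ≠ 0` along `𝓔⁺` (Chruściel–Costa
(2.8)), i.e. every component of `𝓔⁺` is non-degenerate in the printed sense, the opening step of
the non-rotating case of the printed proof. Chruściel–Costa 2008, §2.3 and §7.2. [cite: ChruscielCosta2008, §7.2 (first paragraph) with §2.3 (2.8)] -/
theorem exists_isNull_killing_of_isNonDegenerateHorizon [𝓑.metric.HasLeviCivita]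
    (hnd : 𝓑.toSpacetime.IsNonDegenerateHorizon 𝓑.Mext) :
    ∃ K : Π x : 𝓑.carrier, TangentSpace (𝓡 4) x, 𝓑.metric.IsKillingField K ∧
      (∀ γ : ℝ → 𝓑.carrier, IsMIntegralCurve γ K → γ 0 ∈ 𝓑.horizon → ∀ t, γ t ∈ 𝓑.horizon) ∧
      ∃ κ : ℝ, κ ≠ 0 ∧ ∀ p ∈ 𝓑.horizon,
        𝓑.metric.IsNull (K p) ∧ 𝓑.metric.leviCivita K p (K p) = κ • K p ∧
          ∀ Y₀ : TangentSpace (𝓡 4) p,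
            𝓑.metric.val p (𝓑.metric.leviCivita K p Y₀) (K p) =
              -(κ * 𝓑.metric.val p (K p) Y₀) :=
  hnd.exists_isNull

/-- In particular, under the hypotheses "`𝓔⁺` connected and non-degenerate" of
`ChruscielCosta2008_uniqueness` the horizon is non-empty and the stationary black hole admits a
Killing field which is **null and non-zero somewhere** (at every point of `𝓔⁺`), hence is not
everywhere timelike: the horizon hypotheses are not vacuous and exclude, e.g., Minkowski
space-time packaged with `𝓔⁺ = ∅`. Chruściel–Costa 2008, §7 (the case `𝓔⁺ = ∅` is treated
separately, by the Komar identity and the rigid positive energy theorem). [cite: ChruscielCosta2008, §7 (first sentence) and §7.2] -/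
theorem exists_killing_isNull_of_isConnected_of_isNonDegenerateHorizon [𝓑.metric.HasLeviCivita]
    (hconn : IsConnected 𝓑.horizon) (hnd : 𝓑.toSpacetime.IsNonDegenerateHorizon 𝓑.Mext) :
    ∃ K : Π x : 𝓑.carrier, TangentSpace (𝓡 4) x, 𝓑.metric.IsKillingField K ∧
      ∃ p ∈ 𝓑.horizon, 𝓑.metric.IsNull (K p) := by
  obtain ⟨K, hK, -, κ, -, hp⟩ := exists_isNull_killing_of_isNonDegenerateHorizon hnd
  obtain ⟨p, hp₀⟩ := hconn.nonempty
  exact ⟨K, hK, p, hp₀, (hp p hp₀).1⟩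

end StationaryAFBlackHole


/-! ### The causal structure of `M_ext`, `⟨⟨M_ext⟩⟩` and `𝓔⁺` (Chruściel–Costa 2008, §2.2)

Chruściel–Costa, §2.2 (pp. 6–7 of arXiv:0806.0016): the space-time is *stationary* if it carries
a complete Killing vector field `X₀` timelike on `Σ_ext`; with `φₜ` its flow,
`M_ext := ⋃ₜ φₜ(Σ_ext)` ((2.1)), `⟨⟨M_ext⟩⟩ := I⁺(M_ext) ∩ I⁻(M_ext)` ((2.2)),
`𝓑 := M ∖ I⁻(M_ext)`, `𝓗⁺ := ∂𝓑` ((2.3)), `𝓗⁻ := ∂(M ∖ I⁺(M_ext))` ((2.4)), "it follows that the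
boundaries of `⟨⟨M_ext⟩⟩` are included in the event horizons", and
`𝓔^± := ∂⟨⟨M_ext⟩⟩ ∩ I^±(M_ext)` ((2.6)); §4.1: "by standard causality theory the future event
horizon `𝓗⁺ = İ⁻(M_ext)` is [an achronal Lipschitz hypersurface] … similar definitions apply to any
null achronal hypersurfaces, such as `𝓗⁻` or `𝓔^±`". The statements below are these elementary
consequences of the definitions, in the prelude's rendering (`stationaryOrbit`, `docOfEnd`,
`futureEventHorizonOfEnd`, `blackHoleRegionOfEnd` of `Stationary.lean`), first for a general
time-oriented Lorentzian manifold and then for the hypothesis structure `StationaryAFBlackHole`. -/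

section OrbitCausality

variable {E : Type*} [NormedAddCommGroup E] [NormedSpace ℝ E] {H : Type*} [TopologicalSpace H]
  {I : ModelWithCorners ℝ E H} {M : Type*} [TopologicalSpace M] [ChartedSpace H M]
  [IsManifold I ∞ M] {n : ℕ∞ω}

omit [IsManifold I ∞ M] in
/-- Every point of a whole-line integral curve starting in `A` lies in the orbit `⋃ₜ φₜ(A)`.
Chruściel–Costa 2008, (2.1). [cite: ChruscielCosta2008, §2.2 (2.1)] -/
theorem mem_stationaryOrbit_of_isMIntegralCurve {X₀ : Π x : M, TangentSpace I x} {A : Set M}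
    {γ : ℝ → M} (hγ : IsMIntegralCurve γ X₀) (h0 : γ 0 ∈ A) (t : ℝ) :
    γ t ∈ stationaryOrbit X₀ A :=
  ⟨γ, hγ, h0, t, rfl⟩

/-- **`M_ext = ⋃ₜ φₜ(Σ_ext)` is invariant under the flow of `X₀`.** For a `C¹` vector field `X₀`
on a Hausdorff manifold without boundary, every integral curve `δ` of `X₀` starting at a point of
the orbit `⋃ₜ φₜ(A)` stays in it for all times: `δ 0 = γ t` for an integral curve `γ` from `A`,
and `δ = γ(· + t)` by uniqueness of integral curves. Chruściel–Costa 2008, §2.2 ((2.1): `M_ext`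
is a union of complete orbits of the one-parameter group `φₜ`). [cite: ChruscielCosta2008, §2.2 (2.1)] -/
theorem mem_stationaryOrbit_of_isMIntegralCurve_of_mem [T2Space M] [BoundarylessManifold I M]
    {X₀ : Π x : M, TangentSpace I x} {A : Set M} (hX : CMDiff 1 (T% X₀)) {δ : ℝ → M}
    (hδ : IsMIntegralCurve δ X₀) (h0 : δ 0 ∈ stationaryOrbit X₀ A) (s : ℝ) :
    δ s ∈ stationaryOrbit X₀ A := by
  obtain ⟨γ, hγ, hγ0, t, ht⟩ := h0
  have h : δ = γ ∘ (· + t) :=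
    isMIntegralCurve_Ioo_eq_of_contMDiff_boundaryless (t₀ := 0) hX hδ (hγ.comp_add t)
      (by simp [ht])
  refine ⟨γ, hγ, hγ0, s + t, ?_⟩
  rw [h]
  rfl

/-- **A zero of a vector field is a flow-invariant point**: if `X₀ x = 0` (`X₀` of class `C¹`,
Hausdorff manifold without boundary) the orbit of `{x}` is `{x}` — the constant curve is the
integral curve through `x`. This is the observation "each zero of a Killing vector provides a
compact invariant set" preceding Chruściel–Costa's Cor. 3.8. [cite: ChruscielCosta2008, §3 (before Cor. 3.8)] -/
theorem stationaryOrbit_singleton_eq_of_eq_zero [T2Space M] [BoundarylessManifold I M]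
    {X₀ : Π x : M, TangentSpace I x} (hX : CMDiff 1 (T% X₀)) {x : M} (hx : X₀ x = 0) :
    stationaryOrbit X₀ {x} = {x} := by
  refine Set.Subset.antisymm ?_
    (Set.singleton_subset_iff.2 ⟨fun _ ↦ x, isMIntegralCurve_const hx, rfl, 0, rfl⟩)
  rintro _ ⟨γ, hγ, h0, t, rfl⟩
  rw [Set.mem_singleton_iff] at h0 ⊢
  have h : γ = fun _ ↦ x :=
    isMIntegralCurve_Ioo_eq_of_contMDiff_boundaryless (t₀ := 0) hX hγ (isMIntegralCurve_const hx)
      h0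
  exact congrFun h t

namespace LorentzianMetric

variable {g : LorentzianMetric I n M} {τ : TimeOrientation g}

/-- **Killing orbits in the region where the field is timelike are timelike curves.** An integral
curve `γ` of a vector field `X₀` is a future-directed timelike curve on every parameter set `s`
on which `X₀ (γ t)` is timelike and future-directed (its velocity at `t` is `X₀ (γ t)`; the
case of a field timelike everywhere is `isFutureTimelikeCurveOn_of_isMIntegralCurve` of
`NoncompactCauchyFutureSet.lean`). Chruściel–Costa 2008, §2.2 and §3 ("clearly all orbits of a
Killing vector `X` are future-oriented in the region where `X` is timelike"). [cite: ChruscielCosta2008, §3 (after Cor. 3.3)] -/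
theorem isFutureTimelikeCurveOn_of_isMIntegralCurve_of_forall_mem
    {X₀ : Π x : M, TangentSpace I x} {γ : ℝ → M} (hγ : IsMIntegralCurve γ X₀) {s : Set ℝ}
    (hs : ∀ t ∈ s, g.IsTimelike (X₀ (γ t)) ∧ τ.IsFutureDirected (X₀ (γ t))) :
    g.IsFutureTimelikeCurveOn τ γ s := by
  intro t ht
  refine ⟨(hγ t).mdifferentiableAt, ?_, ?_⟩
  · rw [velocity_eq_of_isMIntegralCurve hγ t]
    exact (hs t ht).1
  · rw [velocity_eq_of_isMIntegralCurve hγ t]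
    exact (hs t ht).2

/-- Along an integral curve `γ` of `X₀` through the region where `X₀` is future timelike, later
points are in the chronological future of earlier ones: `γ b ∈ I⁺(γ a)` for `a < b`.
Chruściel–Costa 2008, §3. [cite: ChruscielCosta2008, §3 (after Cor. 3.3)] -/
theorem apply_mem_chronologicalFuture_of_isMIntegralCurve {X₀ : Π x : M, TangentSpace I x}
    {γ : ℝ → M} (hγ : IsMIntegralCurve γ X₀) {a b : ℝ} (hab : a < b)
    (hs : ∀ t ∈ Set.Icc a b, g.IsTimelike (X₀ (γ t)) ∧ τ.IsFutureDirected (X₀ (γ t))) :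
    γ b ∈ g.chronologicalFuture τ {γ a} :=
  ⟨γ a, rfl, γ, a, b, hab, isFutureTimelikeCurveOn_of_isMIntegralCurve_of_forall_mem hγ hs,
    rfl, rfl⟩

/-- **`M_ext ⊆ I⁺(M_ext)`.** If `X₀` is future timelike on the orbit `M_ext = ⋃ₜ φₜ(A)`, every
point `φₜ(x)` of `M_ext` lies in the chronological future of the point `φ_{t-1}(x) ∈ M_ext` of its
own orbit. Chruściel–Costa 2008, §2.2 ((2.1)–(2.2)). [cite: ChruscielCosta2008, §2.2 (2.1)–(2.2)] -/
theorem stationaryOrbit_subset_chronologicalFuture {X₀ : Π x : M, TangentSpace I x} {A : Set M}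
    (hX : ∀ x ∈ stationaryOrbit X₀ A, g.IsTimelike (X₀ x) ∧ τ.IsFutureDirected (X₀ x)) :
    stationaryOrbit X₀ A ⊆ g.chronologicalFuture τ (stationaryOrbit X₀ A) := by
  rintro _ ⟨γ, hγ, h0, t, rfl⟩
  exact chronologicalFuture_mono
    (Set.singleton_subset_iff.2 (mem_stationaryOrbit_of_isMIntegralCurve hγ h0 (t - 1)))
    (apply_mem_chronologicalFuture_of_isMIntegralCurve hγ (sub_one_lt t)
      fun s _ ↦ hX _ (mem_stationaryOrbit_of_isMIntegralCurve hγ h0 s))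

/-- **`M_ext ⊆ I⁻(M_ext)`** (time dual: `φₜ(x) ≪ φ_{t+1}(x)`). Chruściel–Costa 2008, §2.2
((2.1)–(2.2)). [cite: ChruscielCosta2008, §2.2 (2.1)–(2.2)] -/
theorem stationaryOrbit_subset_chronologicalPast {X₀ : Π x : M, TangentSpace I x} {A : Set M}
    (hX : ∀ x ∈ stationaryOrbit X₀ A, g.IsTimelike (X₀ x) ∧ τ.IsFutureDirected (X₀ x)) :
    stationaryOrbit X₀ A ⊆ g.chronologicalPast τ (stationaryOrbit X₀ A) := by
  rintro _ ⟨γ, hγ, h0, t, rfl⟩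
  have h : γ (t + 1) ∈ g.chronologicalFuture τ {γ t} :=
    apply_mem_chronologicalFuture_of_isMIntegralCurve hγ (lt_add_one t)
      fun s _ ↦ hX _ (mem_stationaryOrbit_of_isMIntegralCurve hγ h0 s)
  exact chronologicalPast_mono
    (Set.singleton_subset_iff.2 (mem_stationaryOrbit_of_isMIntegralCurve hγ h0 (t + 1)))
    (mem_chronologicalPast_of_mem_chronologicalFuture h)

/-- **`M_ext ⊆ ⟨⟨M_ext⟩⟩`**: the asymptotic region lies in its domain of outer communications.
Chruściel–Costa 2008, §2.2 ((2.2)). [cite: ChruscielCosta2008, §2.2 (2.2)] -/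
theorem stationaryOrbit_subset_docOfEnd {X₀ : Π x : M, TangentSpace I x} {A : Set M}
    (hX : ∀ x ∈ stationaryOrbit X₀ A, g.IsTimelike (X₀ x) ∧ τ.IsFutureDirected (X₀ x)) :
    stationaryOrbit X₀ A ⊆ g.docOfEnd τ (stationaryOrbit X₀ A) :=
  Set.subset_inter (stationaryOrbit_subset_chronologicalFuture hX)
    (stationaryOrbit_subset_chronologicalPast hX)

/-- `I⁺(⟨⟨M_ext⟩⟩) ⊆ I⁺(M_ext)` for any `M_ext` (`⟨⟨M_ext⟩⟩ ⊆ I⁺(M_ext)` and `≪` is transitive).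
Chruściel–Costa 2008, §2.2. [cite: ChruscielCosta2008, §2.2 (2.2)] -/
theorem chronologicalFuture_docOfEnd_subset (Mext : Set M) :
    g.chronologicalFuture τ (g.docOfEnd τ Mext) ⊆ g.chronologicalFuture τ Mext := by
  rintro r ⟨q, hq, h⟩
  exact mem_chronologicalFuture_trans hq.1 ⟨q, rfl, h⟩

/-- `I⁻(⟨⟨M_ext⟩⟩) ⊆ I⁻(M_ext)` for any `M_ext`. Chruściel–Costa 2008, §2.2. [cite: ChruscielCosta2008, §2.2 (2.2)] -/
theorem chronologicalPast_docOfEnd_subset (Mext : Set M) :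
    g.chronologicalPast τ (g.docOfEnd τ Mext) ⊆ g.chronologicalPast τ Mext := by
  rintro r ⟨q, hq, h⟩
  exact mem_chronologicalPast_trans hq.2 ⟨q, rfl, h⟩

/-- **`I⁺(⟨⟨M_ext⟩⟩) = I⁺(M_ext)`** as soon as `M_ext ⊆ ⟨⟨M_ext⟩⟩` (the chronological future of
the d.o.c. is that of the asymptotic region; used throughout Chruściel–Costa §3–§4, e.g.
"`I⁺(γ_p) = I⁺(M_ext)`" in the proof of Prop. 4.1). [cite: ChruscielCosta2008, §2.2 (2.2)] -/
theorem chronologicalFuture_docOfEnd_eq {Mext : Set M} (h : Mext ⊆ g.docOfEnd τ Mext) :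
    g.chronologicalFuture τ (g.docOfEnd τ Mext) = g.chronologicalFuture τ Mext :=
  Set.Subset.antisymm (chronologicalFuture_docOfEnd_subset Mext) (chronologicalFuture_mono h)

/-- **`I⁻(⟨⟨M_ext⟩⟩) = I⁻(M_ext)`** as soon as `M_ext ⊆ ⟨⟨M_ext⟩⟩`. Chruściel–Costa 2008, §2.2. [cite: ChruscielCosta2008, §2.2 (2.2)] -/
theorem chronologicalPast_docOfEnd_eq {Mext : Set M} (h : Mext ⊆ g.docOfEnd τ Mext) :
    g.chronologicalPast τ (g.docOfEnd τ Mext) = g.chronologicalPast τ Mext :=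
  Set.Subset.antisymm (chronologicalPast_docOfEnd_subset Mext) (chronologicalPast_mono h)

/-- **The d.o.c. is chronologically convex**: `⟨⟨M_ext⟩⟩ = I⁺(⟨⟨M_ext⟩⟩) ∩ I⁻(⟨⟨M_ext⟩⟩)` when
`M_ext ⊆ ⟨⟨M_ext⟩⟩` (it is the intersection of a future set and a past set; the pointwise causal
convexity — a causal curve between two points of `⟨⟨M_ext⟩⟩` stays in it — is
`LorentzianMetric.mem_docOfEnd_of_mem_causalFuture_of_mem_causalPast` of
`StaticBlackHoleUniquenessProofs.lean`). Chruściel–Costa 2008, §2.2; Hawking–Ellis 1973, §6.3. [cite: ChruscielCosta2008, §2.2 (2.2)] -/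
theorem docOfEnd_eq_inter {Mext : Set M} (h : Mext ⊆ g.docOfEnd τ Mext) :
    g.docOfEnd τ Mext =
      g.chronologicalFuture τ (g.docOfEnd τ Mext) ∩ g.chronologicalPast τ (g.docOfEnd τ Mext) := by
  rw [chronologicalFuture_docOfEnd_eq h, chronologicalPast_docOfEnd_eq h]
  rfl

/-- **"The boundaries of `⟨⟨M_ext⟩⟩` are included in the event horizons"**:
`∂⟨⟨M_ext⟩⟩ ⊆ 𝓗⁺ ∪ 𝓗⁻` with `𝓗⁺ = ∂I⁻(M_ext)` (`= ∂𝓑`) and `𝓗⁻ = ∂I⁺(M_ext)` (the frontier of an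
intersection lies in the union of the frontiers). Chruściel–Costa 2008, §2.2 ((2.3)–(2.5)). [cite: ChruscielCosta2008, §2.2 (2.3)–(2.5)] -/
theorem frontier_docOfEnd_subset (Mext : Set M) :
    frontier (g.docOfEnd τ Mext) ⊆
      frontier (g.chronologicalPast τ Mext) ∪ frontier (g.chronologicalFuture τ Mext) := by
  refine (frontier_inter_subset _ _).trans ?_
  rintro x (hx | hx)
  · exact Or.inr hx.1
  · exact Or.inl hx.2

/-- `𝓗⁺ = ∂I⁻(M_ext) = ∂𝓑`: the frontier of the black-hole region is that of `I⁻(M_ext)`.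
Chruściel–Costa 2008, (2.3). [cite: ChruscielCosta2008, §2.2 (2.3)] -/
theorem frontier_blackHoleRegionOfEnd (Mext : Set M) :
    frontier (g.blackHoleRegionOfEnd τ Mext) = frontier (g.chronologicalPast τ Mext) :=
  frontier_compl _

/-- **`𝓔⁺` is achronal** (manifold without boundary): `𝓔⁺ ⊆ 𝓗⁺ = ∂I⁻(M_ext)`, the boundary of
the past set `I⁻(M_ext)`, which is achronal by Hawking–Ellis' Prop. 6.3.1
(`IsPastSet.isAchronal_frontier`). Chruściel–Costa 2008, §4.1 ("null achronal hypersurfaces,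
such as `𝓗⁻` or `𝓔^±`"); Hawking–Ellis 1973, Prop. 6.3.1. [cite: ChruscielCosta2008, §4.1 (first paragraph)] -/
theorem isAchronal_futureEventHorizonOfEnd [BoundarylessManifold I M] (Mext : Set M) :
    g.IsAchronal τ (g.futureEventHorizonOfEnd τ Mext) := fun p hp q hq ↦
  (isPastSet_chronologicalPast Mext).isAchronal_frontier p hp.1 q hq.1

/-- **`𝓗⁺ = ∂𝓑` is achronal** (manifold without boundary). Chruściel–Costa 2008, §4.1;
Hawking–Ellis 1973, Prop. 6.3.1. [cite: ChruscielCosta2008, §4.1 (first paragraph)] -/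
theorem isAchronal_frontier_blackHoleRegionOfEnd [BoundarylessManifold I M] (Mext : Set M) :
    g.IsAchronal τ (frontier (g.blackHoleRegionOfEnd τ Mext)) := by
  rw [frontier_blackHoleRegionOfEnd]
  exact (isPastSet_chronologicalPast Mext).isAchronal_frontier

/-- **`𝓔⁺ ⊆ 𝓑`**: the future event horizon lies in the black-hole region `M ∖ I⁻(M_ext)`
(`I⁻(M_ext)` is open on a manifold without boundary, hence disjoint from its frontier).
Chruściel–Costa 2008, (2.3)–(2.5). [cite: ChruscielCosta2008, §2.2 (2.3)–(2.5)] -/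
theorem futureEventHorizonOfEnd_subset_blackHoleRegionOfEnd [BoundarylessManifold I M]
    (Mext : Set M) : g.futureEventHorizonOfEnd τ Mext ⊆ g.blackHoleRegionOfEnd τ Mext := by
  intro x hx hxW
  have h : x ∈ g.chronologicalPast τ Mext ∩ frontier (g.chronologicalPast τ Mext) := ⟨hxW, hx.1⟩
  rw [(isOpen_chronologicalPast_of_boundaryless g τ Mext).inter_frontier_eq] at h
  exact h

/-- **`𝓔⁺ ⊆ cl ⟨⟨M_ext⟩⟩`**: every point of the future event horizon is a limit of points of the
domain of outer communications (`I⁺(M_ext)` is an open neighbourhood of it meeting `I⁻(M_ext)`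
arbitrarily close); the form for `StationaryAFBlackHole` (with the openness of `I^±` as
hypotheses) is `StationaryAFBlackHole.horizon_subset_closure_doc` of
`StaticBlackHoleUniquenessProofs.lean`. Chruściel–Costa 2008, (2.6)
(`𝓔⁺ = ∂⟨⟨M_ext⟩⟩ ∩ I⁺(M_ext)`). [cite: ChruscielCosta2008, §2.2 (2.6)] -/
theorem futureEventHorizonOfEnd_subset_closure_docOfEnd [BoundarylessManifold I M]
    (Mext : Set M) : g.futureEventHorizonOfEnd τ Mext ⊆ closure (g.docOfEnd τ Mext) := by
  intro x hx
  have h := (isOpen_chronologicalFuture_of_boundaryless g τ Mext).inter_closure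
    ⟨hx.2, frontier_subset_closure hx.1⟩
  exact h

/-- **Lemma 3.1, the causal core.** If `S` is achronal and `r ∈ S`, then the closure of `S` does
not meet `I⁺(r)`: a point `q ∈ S̄ ∩ I⁺(r)` would be a limit of points `qᵢ ∈ S`, eventually in the
open set `I⁺(r)`, contradicting achronality (manifold without boundary, where `I⁺(r)` is open).
Chruściel–Costa 2008, proof of Lemma 3.1. [cite: ChruscielCosta2008, Lemma 3.1 (proof)] -/
theorem IsAchronal.closure_inter_chronologicalFuture_eq_empty [BoundarylessManifold I M]
    {S : Set M} (hS : g.IsAchronal τ S) {r : M} (hr : r ∈ S) :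
    closure S ∩ g.chronologicalFuture τ {r} = ∅ := by
  refine Set.eq_empty_of_forall_notMem fun q ⟨hq, hqr⟩ ↦ ?_
  obtain ⟨q', hq'I, hq'S⟩ := mem_closure_iff_nhds.mp hq _
    ((isOpen_chronologicalFuture_of_boundaryless g τ {r}).mem_nhds hqr)
  exact hS r hr q' hq'S hq'I

/-- **Strong causality at a point excludes closed causal curves through it**: if strong
causality holds at `p` (on a `T₁` manifold) then no future causal curve `γ : [a, b] → M`, `a < b`,
has `γ a = γ b = p` — the pointwise form of `IsStronglyCausal.isCausallyWellBehaved_holds`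
(`CausalityProofs.lean`): `γ` passes through some `q ≠ p`, and strong causality at `p` applied to
the neighbourhood `{q}ᶜ` of `p` is contradicted by `γ`. O'Neill 1983, Ch. 14, Def. 14.11 and the
remark following it ("there are no causal curves almost closed at `p`"). [cite: ONeillSemiRiemannian1983, Ch. 14, Def. 14.11 ff. (pp. 407–408)] -/
theorem IsStronglyCausalAt.apply_ne_of_isFutureCausalCurveOn [T1Space M] {p : M}
    (h : g.IsStronglyCausalAt τ p) {γ : ℝ → M} {a b : ℝ} (hab : a < b)
    (hγ : g.IsFutureCausalCurveOn τ γ (Set.Icc a b)) (ha : γ a = p) : γ b ≠ p := by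
  intro hb
  obtain ⟨t, ht, hq⟩ := hγ.exists_apply_ne hab
  rw [ha] at hq
  obtain ⟨V, hV, -, hVγ⟩ := h {γ t}ᶜ (compl_singleton_mem_nhds hq.symm)
  have haV : γ a ∈ V := ha ▸ mem_of_mem_nhds hV
  have hbV : γ b ∈ V := hb ▸ mem_of_mem_nhds hV
  exact hVγ γ a b hab hγ haV hbV t ht rfl

end LorentzianMetric

end OrbitCausality

/-! ### The same for the hypothesis structure `StationaryAFBlackHole` (Chruściel–Costa §2.2, §3) -/

namespace StationaryAFBlackHole

variable (𝓑 : StationaryAFBlackHole.{u})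

/-- The embedded far region `Σ_ext = embed (e.far (e.R + 1))` is non-empty (the end is a copy of
`{‖x‖ > R} ⊆ ℝ³`). [folklore] -/
theorem image_far_nonempty : (𝓑.embed '' 𝓑.e.far (𝓑.e.R + 1)).Nonempty := by
  refine Set.Nonempty.image _ ?_
  set t : ℝ := 𝓑.e.R + 2 with ht
  have ht0 : 0 < t := by linarith [𝓑.e.R_pos]
  set z : E3 := t • EuclideanSpace.single (0 : Fin 3) (1 : ℝ) with hz
  have hzn : ‖z‖ = t := by
    rw [hz, norm_smul, Real.norm_of_nonneg ht0.le]
    simp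
  have hzR : z ∈ exteriorRegion 𝓑.e.R := by
    rw [mem_exteriorRegion, hzn, ht]
    linarith
  refine ⟨((𝓑.e.chart.symm ⟨z, hzR⟩ : 𝓑.e.U) : 𝓑.X), 𝓑.e.chart.symm ⟨z, hzR⟩, ?_, rfl⟩
  show 𝓑.e.R + 1 < ‖((𝓑.e.chart (𝓑.e.chart.symm ⟨z, hzR⟩) : exteriorRegion 𝓑.e.R) : E3)‖
  rw [Diffeomorph.apply_symm_apply]
  show 𝓑.e.R + 1 < ‖z‖
  rw [hzn, ht]
  linarith

/-- **`M_ext` is non-empty.** Chruściel–Costa 2008, (2.1). [cite: ChruscielCosta2008, §2.2 (2.1)] -/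
theorem Mext_nonempty [𝓑.metric.HasLeviCivita] : 𝓑.Mext.Nonempty :=
  𝓑.image_far_nonempty.mono 𝓑.image_far_subset_Mext

/-- **The stationary Killing field has no zeros on `M_ext`** (it is timelike there; compare
Chruściel–Costa's Cor. 3.3 and Cor. 3.8, which exclude zeros on `S̄` and on `⟨⟨M_ext⟩⟩`).
Chruściel–Costa 2008, §2.2 and §3. [cite: ChruscielCosta2008, §3 (Cor. 3.3)] -/
theorem killing_ne_zero_of_mem_Mext [𝓑.metric.HasLeviCivita] {x : 𝓑.carrier} (hx : x ∈ 𝓑.Mext) :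
    𝓑.killing x ≠ 0 := by
  intro h0
  have h := (𝓑.isStationaryKilling.isTimelike hx).1
  rw [LorentzianMetric.IsTimelike, h0] at h
  simp at h

/-- **The Killing orbits through `M_ext` are future timelike curves** (on all of `ℝ`): an
integral curve of `X₀` starting in `Σ_ext` stays in `M_ext`, where `X₀` is future timelike.
Chruściel–Costa 2008, §2.2 and §3. [cite: ChruscielCosta2008, §3 (after Cor. 3.3)] -/
theorem isFutureTimelikeCurveOn_of_isMIntegralCurve [𝓑.metric.HasLeviCivita] {γ : ℝ → 𝓑.carrier}
    (hγ : IsMIntegralCurve γ 𝓑.killing) (h0 : γ 0 ∈ 𝓑.embed '' 𝓑.e.far (𝓑.e.R + 1))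
    (s : Set ℝ) : 𝓑.metric.IsFutureTimelikeCurveOn 𝓑.timeOrientation γ s :=
  LorentzianMetric.isFutureTimelikeCurveOn_of_isMIntegralCurve_of_forall_mem hγ fun t _ ↦
    𝓑.isStationaryKilling.isTimelike (mem_stationaryOrbit_of_isMIntegralCurve hγ h0 t)

/-- **`M_ext ⊆ I⁺(M_ext)`.** Chruściel–Costa 2008, §2.2 ((2.1)–(2.2)). [cite: ChruscielCosta2008, §2.2 (2.1)–(2.2)] -/
theorem Mext_subset_chronologicalFuture [𝓑.metric.HasLeviCivita] :
    𝓑.Mext ⊆ 𝓑.metric.chronologicalFuture 𝓑.timeOrientation 𝓑.Mext :=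
  LorentzianMetric.stationaryOrbit_subset_chronologicalFuture
    fun _ hx ↦ 𝓑.isStationaryKilling.isTimelike hx

/-- **`M_ext ⊆ I⁻(M_ext)`.** Chruściel–Costa 2008, §2.2 ((2.1)–(2.2)). [cite: ChruscielCosta2008, §2.2 (2.1)–(2.2)] -/
theorem Mext_subset_chronologicalPast [𝓑.metric.HasLeviCivita] :
    𝓑.Mext ⊆ 𝓑.metric.chronologicalPast 𝓑.timeOrientation 𝓑.Mext :=
  LorentzianMetric.stationaryOrbit_subset_chronologicalPast
    fun _ hx ↦ 𝓑.isStationaryKilling.isTimelike hx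

/-- **`M_ext ⊆ ⟨⟨M_ext⟩⟩`.** Chruściel–Costa 2008, §2.2 ((2.2)). [cite: ChruscielCosta2008, §2.2 (2.2)] -/
theorem Mext_subset_doc [𝓑.metric.HasLeviCivita] : 𝓑.Mext ⊆ 𝓑.doc :=
  LorentzianMetric.stationaryOrbit_subset_docOfEnd fun _ hx ↦ 𝓑.isStationaryKilling.isTimelike hx

/-- `Σ_ext ⊆ ⟨⟨M_ext⟩⟩`. Chruściel–Costa 2008, §2.2 and Def. 1.1 (`S ⊇ Σ_ext` lies in
`⟨⟨M_ext⟩⟩`). [cite: ChruscielCosta2008, §2.2 (2.2)] -/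
theorem image_far_subset_doc [𝓑.metric.HasLeviCivita] :
    𝓑.embed '' 𝓑.e.far (𝓑.e.R + 1) ⊆ 𝓑.doc :=
  𝓑.image_far_subset_Mext.trans 𝓑.Mext_subset_doc

/-- **The domain of outer communications is non-empty.** Chruściel–Costa 2008, §2.2. [cite: ChruscielCosta2008, §2.2 (2.2)] -/
theorem doc_nonempty [𝓑.metric.HasLeviCivita] : 𝓑.doc.Nonempty :=
  𝓑.Mext_nonempty.mono 𝓑.Mext_subset_doc

/-- **`I⁺(⟨⟨M_ext⟩⟩) = I⁺(M_ext)`.** Chruściel–Costa 2008, §2.2; used e.g. in the proof of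
Prop. 4.1 ("`I⁺(γ_p) = I⁺(M_ext)`"). [cite: ChruscielCosta2008, §2.2 (2.2)] -/
theorem chronologicalFuture_doc [𝓑.metric.HasLeviCivita] :
    𝓑.metric.chronologicalFuture 𝓑.timeOrientation 𝓑.doc =
      𝓑.metric.chronologicalFuture 𝓑.timeOrientation 𝓑.Mext :=
  LorentzianMetric.chronologicalFuture_docOfEnd_eq 𝓑.Mext_subset_doc

/-- **`I⁻(⟨⟨M_ext⟩⟩) = I⁻(M_ext)`.** Chruściel–Costa 2008, §2.2. [cite: ChruscielCosta2008, §2.2 (2.2)] -/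
theorem chronologicalPast_doc [𝓑.metric.HasLeviCivita] :
    𝓑.metric.chronologicalPast 𝓑.timeOrientation 𝓑.doc =
      𝓑.metric.chronologicalPast 𝓑.timeOrientation 𝓑.Mext :=
  LorentzianMetric.chronologicalPast_docOfEnd_eq 𝓑.Mext_subset_doc

/-- **`⟨⟨M_ext⟩⟩` is chronologically convex**: `⟨⟨M_ext⟩⟩ = I⁺(⟨⟨M_ext⟩⟩) ∩ I⁻(⟨⟨M_ext⟩⟩)`.
Chruściel–Costa 2008, §2.2. [cite: ChruscielCosta2008, §2.2 (2.2)] -/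
theorem doc_eq_inter [𝓑.metric.HasLeviCivita] :
    𝓑.doc = 𝓑.metric.chronologicalFuture 𝓑.timeOrientation 𝓑.doc ∩
      𝓑.metric.chronologicalPast 𝓑.timeOrientation 𝓑.doc :=
  LorentzianMetric.docOfEnd_eq_inter 𝓑.Mext_subset_doc

/-- **`∂⟨⟨M_ext⟩⟩ ⊆ 𝓗⁺ ∪ 𝓗⁻`.** Chruściel–Costa 2008, §2.2 ("the boundaries of `⟨⟨M_ext⟩⟩` are
included in the event horizons"). [cite: ChruscielCosta2008, §2.2 (2.3)–(2.5)] -/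
theorem frontier_doc_subset :
    frontier 𝓑.doc ⊆ frontier 𝓑.blackHoleRegion ∪
      frontier (𝓑.metric.chronologicalFuture 𝓑.timeOrientation 𝓑.Mext) := by
  rw [blackHoleRegion, Spacetime.blackHoleRegionOfEnd,
    LorentzianMetric.frontier_blackHoleRegionOfEnd]
  exact LorentzianMetric.frontier_docOfEnd_subset 𝓑.Mext

/-- **`𝓔⁺` is achronal.** Chruściel–Costa 2008, §4.1; Hawking–Ellis 1973, Prop. 6.3.1. [cite: ChruscielCosta2008, §4.1 (first paragraph)] -/
theorem isAchronal_horizon : 𝓑.metric.IsAchronal 𝓑.timeOrientation 𝓑.horizon :=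
  LorentzianMetric.isAchronal_futureEventHorizonOfEnd 𝓑.Mext

/-- **`𝓗⁺ = ∂𝓑` is achronal.** Chruściel–Costa 2008, §4.1; Hawking–Ellis 1973, Prop. 6.3.1. [cite: ChruscielCosta2008, §4.1 (first paragraph)] -/
theorem isAchronal_frontier_blackHoleRegion :
    𝓑.metric.IsAchronal 𝓑.timeOrientation (frontier 𝓑.blackHoleRegion) :=
  LorentzianMetric.isAchronal_frontier_blackHoleRegionOfEnd 𝓑.Mext

/-- **`𝓔⁺ ⊆ 𝓑`**: the future event horizon lies in the black-hole region. Chruściel–Costa 2008,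
(2.3)–(2.5). [cite: ChruscielCosta2008, §2.2 (2.3)–(2.5)] -/
theorem horizon_subset_blackHoleRegion : 𝓑.horizon ⊆ 𝓑.blackHoleRegion :=
  LorentzianMetric.futureEventHorizonOfEnd_subset_blackHoleRegionOfEnd 𝓑.Mext

/-- **`M_ext` is invariant under the stationary flow**: an integral curve of `X₀` which starts in
`M_ext` stays in `M_ext` (uniqueness of integral curves of the smooth field `X₀`). Chruściel–Costa
2008, §2.2 ((2.1)). [cite: ChruscielCosta2008, §2.2 (2.1)] -/
theorem Mext_invariant [𝓑.metric.HasLeviCivita] {δ : ℝ → 𝓑.carrier}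
    (hδ : IsMIntegralCurve δ 𝓑.killing) (h0 : δ 0 ∈ 𝓑.Mext) (s : ℝ) : δ s ∈ 𝓑.Mext :=
  mem_stationaryOrbit_of_isMIntegralCurve_of_mem
    (𝓑.isStationaryKilling.isKillingField.contMDiff.of_le (by exact_mod_cast le_top)) hδ h0 s

/-- A zero of the stationary Killing field is a fixed point of its flow: the orbit of `{x}` is
`{x}` (the remark "each zero of a Killing vector provides a compact invariant set" before
Chruściel–Costa's Cor. 3.8). [cite: ChruscielCosta2008, §3 (before Cor. 3.8)] -/
theorem stationaryOrbit_killing_singleton_eq [𝓑.metric.HasLeviCivita] {x : 𝓑.carrier}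
    (hx : 𝓑.killing x = 0) : 𝓑.toSpacetime.stationaryOrbit 𝓑.killing {x} = {x} :=
  stationaryOrbit_singleton_eq_of_eq_zero
    (𝓑.isStationaryKilling.isKillingField.contMDiff.of_le (by exact_mod_cast le_top)) hx

/-- **In an `I⁺`-regular black hole the stationary isometry group acts freely on `M_ext`**: every
Killing orbit through `M_ext` is an injective curve. Such an orbit stays in `M_ext ⊆ ⟨⟨M_ext⟩⟩`
(`Mext_invariant`, `Mext_subset_doc`) and is a future timelike curve there; if it returned to one
of its points it would be a closed timelike curve through a point of `⟨⟨M_ext⟩⟩`, where strong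
causality holds (`IsIPlusRegular`: `⟨⟨M_ext⟩⟩` is a globally hyperbolic set). This is the freeness
of the `ℝ`-action by `φₜ` on `M_ext` underlying Chruściel–Costa's "the flow of `K₀` in `M_ext` is
by time translations" (§4.2, proof of the structure theorem 4.5) and Cor. 3.8 (no zeros, i.e. no
fixed points, in `⟨⟨M_ext⟩⟩`). [cite: ChruscielCosta2008, §4.2 (proof of Thm. 4.5)] -/
theorem IsIPlusRegular.injective_of_isMIntegralCurve {𝓑 : StationaryAFBlackHole.{u}}
    [𝓑.metric.HasLeviCivita] (h : 𝓑.IsIPlusRegular) {γ : ℝ → 𝓑.carrier}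
    (hγ : IsMIntegralCurve γ 𝓑.killing) (h0 : γ 0 ∈ 𝓑.Mext) : Function.Injective γ := by
  have hmem : ∀ u, γ u ∈ 𝓑.Mext := 𝓑.Mext_invariant hγ h0
  have hcurve : ∀ s t : ℝ, s < t → γ t ≠ γ s := fun s t hst ↦
    (h.isStronglyCausalAt (𝓑.Mext_subset_doc (hmem s))).apply_ne_of_isFutureCausalCurveOn hst
      (LorentzianMetric.isFutureTimelikeCurveOn_of_isMIntegralCurve_of_forall_mem hγ fun u _ ↦
        𝓑.isStationaryKilling.isTimelike (hmem u)).isFutureCausalCurveOn rfl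
  intro s t hst
  by_contra hne
  rcases lt_or_gt_of_ne hne with hlt | hlt
  · exact hcurve s t hlt hst.symm
  · exact hcurve t s hlt hst

/-- **No closed Killing orbits through `M_ext`** in an `I⁺`-regular black hole: an integral curve
of `X₀` through `M_ext` has no non-zero period (the group generated by `X₀` acting on `M_ext` is
`ℝ`, not `U(1)`). Chruściel–Costa 2008, §4.2. [cite: ChruscielCosta2008, §4.2 (proof of Thm. 4.5)] -/
theorem IsIPlusRegular.not_periodic_of_isMIntegralCurve {𝓑 : StationaryAFBlackHole.{u}}
    [𝓑.metric.HasLeviCivita] (h : 𝓑.IsIPlusRegular) {γ : ℝ → 𝓑.carrier}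
    (hγ : IsMIntegralCurve γ 𝓑.killing) (h0 : γ 0 ∈ 𝓑.Mext) {c : ℝ} (hc : c ≠ 0) :
    ¬ Function.Periodic γ c := by
  intro hp
  have h0c : (0 : ℝ) + c = 0 := h.injective_of_isMIntegralCurve hγ h0 (hp 0)
  exact hc (by simpa using h0c)

namespace IPlusRegularHypersurface

variable {𝓑} (𝒮 : 𝓑.IPlusRegularHypersurface)

/-- **Lemma 3.1, for a point of `S`.** The closure `S̄` of the hypersurface of Def. 1.1 does not
meet the chronological future of any of the points of `S` (`S` is acausal, hence achronal, and
`I⁺(r)` is open). Chruściel–Costa 2008, Lemma 3.1 (proof). [cite: ChruscielCosta2008, Lemma 3.1] -/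
theorem closure_carrierSet_inter_chronologicalFuture_eq_empty {r : 𝓑.carrier}
    (hr : r ∈ 𝒮.carrierSet) :
    closure 𝒮.carrierSet ∩ 𝓑.metric.chronologicalFuture 𝓑.timeOrientation {r} = ∅ :=
  𝒮.isAchronal.closure_inter_chronologicalFuture_eq_empty hr

/-- In particular the boundary `∂S̄ = S̄ ∖ S ⊆ 𝓔⁺` does not meet `I⁺(r)` for `r ∈ S`.
Chruściel–Costa 2008, Lemma 3.1. [cite: ChruscielCosta2008, Lemma 3.1] -/
theorem boundarySet_inter_chronologicalFuture_eq_empty {r : 𝓑.carrier} (hr : r ∈ 𝒮.carrierSet) :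
    𝒮.boundarySet ∩ 𝓑.metric.chronologicalFuture 𝓑.timeOrientation {r} = ∅ :=
  Set.subset_eq_empty (Set.inter_subset_inter_left _ Set.sdiff_subset)
    (𝒮.closure_carrierSet_inter_chronologicalFuture_eq_empty hr)

/-- **Lemma 3.1** (Chruściel–Costa 2008). Let `S ⊇ Σ_ext` be the acausal hypersurface of
Def. 1.1 in `⟨⟨M_ext⟩⟩`. Then for every `p ∈ M_ext` there is a point `r = φ_{t₀}(p) ∈ Σ_ext` on the
Killing orbit through `p` (an integral curve `γ` of `X₀` with `γ 0 = r`, `γ t = p`) such that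
`S̄ ∩ I⁺(r) = ∅`. Printed proof: "There exists `t₀` such that `r := φ_{t₀}(p) ∈ Σ_ext`. Suppose
that `S̄ ∩ I⁺(φ_{t₀}(p)) ≠ ∅`. Then there exists a timelike future directed curve from `r` to
`q ∈ S̄`. Let `qᵢ ∈ S` converge to `q`; then `qᵢ ∈ I⁺(r)` for `i` large enough, which contradicts
achronality of `S`." (The tree's `S` is acausal in `M`, which implies the printed "achronal in
`⟨⟨M_ext⟩⟩`".) [cite: ChruscielCosta2008, Lemma 3.1] -/
theorem exists_mem_far_closure_inter_chronologicalFuture_eq_empty {p : 𝓑.carrier}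
    (hp : p ∈ 𝓑.Mext) :
    ∃ r ∈ 𝓑.embed '' 𝓑.e.far (𝓑.e.R + 1),
      (∃ γ : ℝ → 𝓑.carrier, IsMIntegralCurve γ 𝓑.killing ∧ γ 0 = r ∧ ∃ t, γ t = p) ∧
        closure 𝒮.carrierSet ∩ 𝓑.metric.chronologicalFuture 𝓑.timeOrientation {r} = ∅ := by
  obtain ⟨γ, hγ, h0, t, rfl⟩ := hp
  exact ⟨γ 0, h0, ⟨γ, hγ, rfl, t, rfl⟩,
    𝒮.closure_carrierSet_inter_chronologicalFuture_eq_empty (𝒮.image_far_subset_range h0)⟩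

/-- Consequently no point of `S̄` — in particular no point of `∂S̄ ⊆ 𝓔⁺` — lies in the
chronological future of `Σ_ext`: `S̄ ∩ I⁺(Σ_ext) = ∅`. Chruściel–Costa 2008, Lemma 3.1. [cite: ChruscielCosta2008, Lemma 3.1] -/
theorem closure_carrierSet_inter_chronologicalFuture_image_far_eq_empty :
    closure 𝒮.carrierSet ∩
      𝓑.metric.chronologicalFuture 𝓑.timeOrientation (𝓑.embed '' 𝓑.e.far (𝓑.e.R + 1)) = ∅ := by
  refine Set.eq_empty_of_forall_notMem fun q ⟨hq, r, hr, h⟩ ↦ ?_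
  have h' : q ∈ closure 𝒮.carrierSet ∩ 𝓑.metric.chronologicalFuture 𝓑.timeOrientation {r} :=
    ⟨hq, r, rfl, h⟩
  rw [𝒮.closure_carrierSet_inter_chronologicalFuture_eq_empty (𝒮.image_far_subset_range hr)] at h'
  exact h'

end IPlusRegularHypersurface

end StationaryAFBlackHole

/-! ### Corollary 3.3: the stationary Killing field has no zeros on `S̄` (Chruściel–Costa §3)

Chruściel–Costa 2008, Cor. 3.3 (p. 9 of arXiv:0806.0016): "If `r ∈ S̄ ∩ I⁺(M_ext)`, then the
stationary Killing vector `X` does not vanish at `r`. In particular if `(M, g)` is `I⁺`-regular,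
then `X` has no zeros on `S̄`." Printed proof: "It follows from Lemma 3.1, together with point 1 of
Lemma 3.2 with `S = {r}`" — i.e.: `r ∈ I⁺(p)` for some `p ∈ M_ext` (for a single point this is the
definition of `I⁺(M_ext)`, no compactness argument is needed); by Lemma 3.1 there is `t₀` with
`S̄ ∩ I⁺(φ_{t₀}(p)) = ∅`; a zero `r` of `X` is a fixed point of the flow, and `φ_{t₀}` is a
time-orientation-preserving isometry (`KillingFlowIsometry.lean`), so
`r = φ_{t₀}(r) ∈ I⁺(φ_{t₀}(p))`, contradicting `r ∈ S̄`. For the hypersurface of Def. 1.1 one has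
moreover `S̄ = S ∪ ∂S̄ ⊆ ⟨⟨M_ext⟩⟩ ∪ 𝓔⁺ ⊆ I⁺(M_ext)`, whence the second assertion. -/

namespace StationaryAFBlackHole

namespace IPlusRegularHypersurface

variable {𝓑 : StationaryAFBlackHole.{u}} (𝒮 : 𝓑.IPlusRegularHypersurface)

/-- `S̄ ⊆ I⁺(M_ext)` for the hypersurface `S` of Def. 1.1: `S ⊆ ⟨⟨M_ext⟩⟩ ⊆ I⁺(M_ext)` and
`∂S̄ ⊆ 𝓔⁺ ⊆ I⁺(M_ext)`. Chruściel–Costa 2008, Def. 1.1 with (2.2), (2.6). [cite: ChruscielCosta2008, Def. 1.1 and §2.2 (2.6)] -/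
theorem closure_carrierSet_subset_chronologicalFuture_Mext :
    closure 𝒮.carrierSet ⊆ 𝓑.metric.chronologicalFuture 𝓑.timeOrientation 𝓑.Mext := by
  intro q hq
  by_cases hqS : q ∈ 𝒮.carrierSet
  · exact (𝒮.carrierSet_subset_doc hqS).1
  · exact (𝒮.boundarySet_subset_horizon ⟨hq, hqS⟩).2

/-- **Corollary 3.3** (Chruściel–Costa 2008). The stationary Killing field `X₀` of a stationary
asymptotically flat black hole has **no zeros on the closure `S̄`** of the hypersurface `S` of
Def. 1.1 — in particular none on the cross-section `∂S̄` of `𝓔⁺`. Proof as printed (with Lemma 3.1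
in the form `exists_mem_far_closure_inter_chronologicalFuture_eq_empty` and the flow of `X₀` from
`StationaryAFBlackHole.exists_stationary_flow`): `r ∈ S̄ ⊆ I⁺(M_ext)` gives `p = φ_t(r₀) ∈ M_ext`,
`r₀ ∈ Σ_ext ⊆ S`, with `r ∈ I⁺(p)` and `S̄ ∩ I⁺(r₀) = ∅`; if `X₀(r) = 0` then `r` is fixed by the
flow, and applying the time-orientation-preserving isometry `φ₋ₜ` to `r ∈ I⁺(p)` gives
`r ∈ I⁺(φ₋ₜ(p)) = I⁺(r₀)`, a contradiction. [cite: ChruscielCosta2008, Cor. 3.3] -/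
theorem killing_ne_zero_of_mem_closure_carrierSet [𝓑.metric.HasLeviCivita] {r : 𝓑.carrier}
    (hr : r ∈ closure 𝒮.carrierSet) : 𝓑.killing r ≠ 0 := by
  intro h0
  obtain ⟨θ, hθ, hθ0, hθadd, hθX, -⟩ := 𝓑.exists_stationary_flow
  have hK : 𝓑.metric.IsKillingField 𝓑.killing := 𝓑.isStationaryKilling.isKillingField
  have hK1 : ContMDiff (𝓡 4) (𝓡 4).tangent 1
      (fun x ↦ (⟨x, 𝓑.killing x⟩ : TangentBundle (𝓡 4) 𝓑.carrier)) :=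
    hK.contMDiff.of_le (WithTop.coe_le_coe.mpr le_top)
  have hθ2 : ContMDiff (𝓘(ℝ, ℝ).prod (𝓡 4)) (𝓡 4) 2 θ := hθ.of_le (WithTop.coe_le_coe.mpr le_top)
  -- `r ∈ I⁺(p)` with `p = γ t ∈ M_ext`, `γ` the Killing orbit of `r₀ = γ 0 ∈ Σ_ext ⊆ S`
  obtain ⟨_, ⟨γ, hγ, hγ0, t, rfl⟩, hcurve⟩ :=
    𝒮.closure_carrierSet_subset_chronologicalFuture_Mext hr
  -- Lemma 3.1: `S̄ ∩ I⁺(r₀) = ∅`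
  have h31 := 𝒮.closure_carrierSet_inter_chronologicalFuture_eq_empty (𝒮.image_far_subset_range hγ0)
  -- the flow: `φ₋ₜ(γ t) = γ 0` and `φ₋ₜ(r) = r`
  have hflowγ : θ (-t, γ t) = γ 0 := by
    rw [eq_flow_of_isMIntegralCurve hK1 hθX hθ0 hγ t, flow_neg_apply_flow hθ0 hθadd]
  have hfix : θ (-t, r) = r :=
    (eq_flow_of_isMIntegralCurve hK1 hθX hθ0 (isMIntegralCurve_const h0) (-t)).symm
  -- `φ₋ₜ` maps `I⁺(γ t)` onto `I⁺(γ 0)`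
  have hmem : r ∈ (fun q ↦ θ (-t, q)) '' 𝓑.metric.chronologicalFuture 𝓑.timeOrientation {γ t} :=
    ⟨r, ⟨γ t, rfl, hcurve⟩, hfix⟩
  rw [hK.image_flow_chronologicalFuture (τ := 𝓑.timeOrientation) hθ2 hθ0 hθadd hθX (-t) {γ t}]
    at hmem
  simp only [Set.image_singleton] at hmem
  rw [hflowγ] at hmem
  have h : r ∈ closure 𝒮.carrierSet ∩ 𝓑.metric.chronologicalFuture 𝓑.timeOrientation {γ 0} :=
    ⟨hr, hmem⟩
  rw [h31] at h
  exact h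

/-- In particular `X₀` has no zeros on `S` itself. Chruściel–Costa 2008, Cor. 3.3. [cite: ChruscielCosta2008, Cor. 3.3] -/
theorem killing_ne_zero_of_mem_carrierSet [𝓑.metric.HasLeviCivita] {r : 𝓑.carrier}
    (hr : r ∈ 𝒮.carrierSet) : 𝓑.killing r ≠ 0 :=
  𝒮.killing_ne_zero_of_mem_closure_carrierSet (subset_closure hr)

/-- In particular `X₀` has no zeros on the boundary `∂S̄ ⊆ 𝓔⁺` (a compact cross-section of the
future event horizon) — the form in which Cor. 3.3 enters the proof of the structure theorem 4.5
("it will be essential to have no zeros of the stationary Killing vector on `S̄`", §3).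
Chruściel–Costa 2008, Cor. 3.3. [cite: ChruscielCosta2008, Cor. 3.3] -/
theorem killing_ne_zero_of_mem_boundarySet [𝓑.metric.HasLeviCivita] {r : 𝓑.carrier}
    (hr : r ∈ 𝒮.boundarySet) : 𝓑.killing r ≠ 0 :=
  𝒮.killing_ne_zero_of_mem_closure_carrierSet hr.1

end IPlusRegularHypersurface

/-- **Corollary 3.3, `I⁺`-regular form**: in an `I⁺`-regular stationary AF black hole the
stationary Killing field has no zeros on the closure of the hypersurface of Def. 1.1 ("in
particular if `(M, g)` is `I⁺`-regular, then `X` has no zeros on `S̄`"). Chruściel–Costa 2008,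
Cor. 3.3. [cite: ChruscielCosta2008, Cor. 3.3] -/
theorem IsIPlusRegular.exists_hypersurface_killing_ne_zero {𝓑 : StationaryAFBlackHole.{u}}
    [𝓑.metric.HasLeviCivita] (h : 𝓑.IsIPlusRegular) :
    ∃ 𝒮 : 𝓑.IPlusRegularHypersurface, ∀ r ∈ closure 𝒮.carrierSet, 𝓑.killing r ≠ 0 := by
  obtain ⟨𝒮⟩ := h.nonempty_hypersurface
  exact ⟨𝒮, fun r hr ↦ 𝒮.killing_ne_zero_of_mem_closure_carrierSet hr⟩

/-- **The stationary Killing field is tangent to `𝓔⁺` and to `⟨⟨M_ext⟩⟩`**: its integral curves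
starting on the future event horizon (resp. in the d.o.c.) stay there — the flow-invariance of
`𝓔⁺` and `⟨⟨M_ext⟩⟩` (`KillingFlowIsometry.lean`) read along orbits. This is the tangency clause of
`LorentzianMetric.IsNonDegenerateHorizon` for `K = X₀` (the static case). Chruściel–Costa 2008,
§2.2 and Prop. 4.1 (`𝓔₀ = ⋃ₜ φₜ(S₀)`). [cite: ChruscielCosta2008, Prop. 4.1] -/
theorem mem_horizon_of_isMIntegralCurve {𝓑 : StationaryAFBlackHole.{u}} [𝓑.metric.HasLeviCivita]
    {γ : ℝ → 𝓑.carrier}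
    (hγ : IsMIntegralCurve γ 𝓑.killing) (h0 : γ 0 ∈ 𝓑.horizon) (t : ℝ) : γ t ∈ 𝓑.horizon := by
  obtain ⟨θ, hθ, hθ0, -, hθX, -, -, -, -, -, -, -, hH⟩ := 𝓑.exists_stationary_flow
  have hK1 : ContMDiff (𝓡 4) (𝓡 4).tangent 1
      (fun x ↦ (⟨x, 𝓑.killing x⟩ : TangentBundle (𝓡 4) 𝓑.carrier)) :=
    𝓑.isStationaryKilling.isKillingField.contMDiff.of_le (WithTop.coe_le_coe.mpr le_top)
  rw [eq_flow_of_isMIntegralCurve hK1 hθX hθ0 hγ t, ← hH t]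
  exact Set.mem_image_of_mem _ h0

/-- Integral curves of `X₀` starting in `⟨⟨M_ext⟩⟩` stay in `⟨⟨M_ext⟩⟩`. Chruściel–Costa 2008,
§2.2. [cite: ChruscielCosta2008, §2.2 (2.2)] -/
theorem mem_doc_of_isMIntegralCurve {𝓑 : StationaryAFBlackHole.{u}} [𝓑.metric.HasLeviCivita]
    {γ : ℝ → 𝓑.carrier}
    (hγ : IsMIntegralCurve γ 𝓑.killing) (h0 : γ 0 ∈ 𝓑.doc) (t : ℝ) : γ t ∈ 𝓑.doc := by
  obtain ⟨θ, hθ, hθ0, -, hθX, -, -, -, -, -, hD, -, -⟩ := 𝓑.exists_stationary_flow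
  have hK1 : ContMDiff (𝓡 4) (𝓡 4).tangent 1
      (fun x ↦ (⟨x, 𝓑.killing x⟩ : TangentBundle (𝓡 4) 𝓑.carrier)) :=
    𝓑.isStationaryKilling.isKillingField.contMDiff.of_le (WithTop.coe_le_coe.mpr le_top)
  rw [eq_flow_of_isMIntegralCurve hK1 hθX hθ0 hγ t, ← hD t]
  exact Set.mem_image_of_mem _ h0

end StationaryAFBlackHole

/-! ### Connectedness of `Σ_ext` and `M_ext` (private copies)

The preconnectedness of the embedded far region `Σ_ext` and of `M_ext` is proved in the sibling
`StaticBlackHoleUniquenessProofs.lean` (`isPreconnected_image_far`, `isConnected_Mext`, from the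
path-connectedness of the exterior `{r < ‖x‖}` of a ball in `ℝ³`); the proofs are repeated here as
private copies rather than importing that (independently evolving) file, exactly as that file does
with `Mext_subset_doc` of the present one. -/

section ConnectedAux

/-- The exterior `{x : ℝ³ | r < ‖x‖}` of a closed ball (`0 ≤ r`) is path connected: it is the image
of `(r, ∞) × S²` under `(t, u) ↦ t u`. [folklore] -/
private theorem E3_isPathConnected_normGt_aux {r : ℝ} (hr : 0 ≤ r) :
    IsPathConnected {x : E3 | r < ‖x‖} := by
  have hrank : 1 < Module.rank ℝ E3 := by
    rw [← Module.finrank_eq_rank, finrank_euclideanSpace_fin]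
    norm_num
  have hs : IsPathConnected (Metric.sphere (0 : E3) 1) := isPathConnected_sphere hrank 0 zero_le_one
  have hIoi : IsPathConnected (Set.Ioi r) := (convex_Ioi r).isPathConnected ⟨r + 1, by simp⟩
  have hprod : IsPathConnected (Set.Ioi r ×ˢ Metric.sphere (0 : E3) 1) := hIoi.prod hs
  have hcont : Continuous fun p : ℝ × E3 ↦ p.1 • p.2 := continuous_fst.smul continuous_snd
  have himg := hprod.image (f := fun p : ℝ × E3 ↦ p.1 • p.2) hcont
  have heq : (fun p : ℝ × E3 ↦ p.1 • p.2) '' (Set.Ioi r ×ˢ Metric.sphere (0 : E3) 1) =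
      {x : E3 | r < ‖x‖} := by
    ext x
    simp only [Set.mem_image, Set.mem_prod, Set.mem_Ioi, mem_sphere_iff_norm, sub_zero,
      Set.mem_setOf_eq, Prod.exists]
    constructor
    · rintro ⟨t, u, ⟨ht, hu⟩, rfl⟩
      rw [norm_smul, hu, mul_one, Real.norm_of_nonneg (hr.trans ht.le)]
      exact ht
    · intro hx
      have hx0 : 0 < ‖x‖ := hr.trans_lt hx
      refine ⟨‖x‖, ‖x‖⁻¹ • x, ⟨hx, ?_⟩, ?_⟩
      · rw [norm_smul, norm_inv, norm_norm, inv_mul_cancel₀ hx0.ne']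
      · rw [smul_smul, mul_inv_cancel₀ hx0.ne', one_smul]
  rw [← heq]
  exact himg

variable {Y : Type u} [TopologicalSpace Y] [ChartedSpace E3 Y]

/-- Far regions `e.far R'`, `R ≤ R'`, of an asymptotically flat end are preconnected (image of
`{R' < ‖x‖}` under the inverse chart; universe-polymorphic private copy of
`AFEnd.isPreconnected_far'` of `StaticBlackHoleUniquenessProofs.lean`). Bartnik 1986, §1. [cite: Bartnik1986, §1] -/
private theorem AFEnd_isPreconnected_far_aux (e : AFEnd Y) {R' : ℝ} (hR' : e.R ≤ R') :
    IsPreconnected (e.far R') := by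
  set S : Set (exteriorRegion e.R) := {z | R' < ‖(z : E3)‖} with hS
  have hSimg : Subtype.val '' S = {x : E3 | R' < ‖x‖} := by
    ext x
    constructor
    · rintro ⟨z, hz, rfl⟩
      exact hz
    · intro hx
      exact ⟨⟨x, (mem_exteriorRegion).2 (hR'.trans_lt hx)⟩, hx, rfl⟩
  have hSconn : IsPreconnected S := by
    have h' : IsPreconnected (Subtype.val '' S) := by
      rw [hSimg]
      exact (E3_isPathConnected_normGt_aux (e.R_pos.le.trans hR')).isConnected.isPreconnected
    exact (Topology.IsInducing.subtypeVal.isPreconnected_image).mp h'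
  have hfar : e.far R' = (fun z ↦ ((e.chart.symm z : e.U) : Y)) '' S := by
    ext q
    constructor
    · rintro ⟨y, hy, rfl⟩
      refine ⟨e.chart y, hy, ?_⟩
      show ((e.chart.symm (e.chart y) : e.U) : Y) = y
      rw [e.chart.symm_apply_apply]
    · rintro ⟨z, hz, rfl⟩
      refine ⟨e.chart.symm z, ?_, rfl⟩
      show R' < ‖((e.chart (e.chart.symm z) : exteriorRegion e.R) : E3)‖
      rw [e.chart.apply_symm_apply]
      exact hz
  rw [hfar]
  exact hSconn.image _ (continuous_subtype_val.comp e.chart.symm.continuous).continuousOn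

end ConnectedAux

namespace StationaryAFBlackHole

/-- The embedded far region `embed(Σ_ext')` is preconnected (private copy of
`isPreconnected_image_far` of `StaticBlackHoleUniquenessProofs.lean`). Chruściel–Costa 2008, §2.1. [cite: ChruscielCosta2008, §2.1] -/
private theorem isPreconnected_image_far_aux (𝓑 : StationaryAFBlackHole.{u}) :
    IsPreconnected (𝓑.embed '' 𝓑.e.far (𝓑.e.R + 1)) :=
  (AFEnd_isPreconnected_far_aux 𝓑.e (by linarith)).image _
    𝓑.isSmoothEmbedding.isEmbedding.continuous.continuousOn

/-- `M_ext = ⋃ₜ φₜ(Σ_ext')` is preconnected: the union of the (connected) Killing orbits through the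
(preconnected) embedded far region (private copy of `isConnected_Mext` of
`StaticBlackHoleUniquenessProofs.lean`). Chruściel–Costa 2008, (2.1). [cite: ChruscielCosta2008, §2.2 (2.1)] -/
private theorem isPreconnected_Mext_aux (𝓑 : StationaryAFBlackHole.{u}) [𝓑.metric.HasLeviCivita] :
    IsPreconnected 𝓑.Mext := by
  obtain ⟨x₀, hx₀⟩ := 𝓑.image_far_nonempty
  set A : Set 𝓑.carrier := 𝓑.embed '' 𝓑.e.far (𝓑.e.R + 1) with hA
  let c : Set (Set 𝓑.carrier) :=
    {D | ∃ γ : ℝ → 𝓑.carrier, IsMIntegralCurve γ 𝓑.killing ∧ γ 0 ∈ A ∧ D = A ∪ Set.range γ}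
  have hunion : 𝓑.Mext = ⋃₀ c := by
    ext p
    constructor
    · rintro ⟨γ, hγ, h0, t, rfl⟩
      exact Set.mem_sUnion.2 ⟨A ∪ Set.range γ, ⟨γ, hγ, h0, rfl⟩, Or.inr ⟨t, rfl⟩⟩
    · intro hp
      obtain ⟨D, ⟨γ, hγ, h0, rfl⟩, hpD⟩ := Set.mem_sUnion.1 hp
      rcases hpD with hpA | ⟨t, rfl⟩
      · exact 𝓑.image_far_subset_Mext hpA
      · exact ⟨γ, hγ, h0, t, rfl⟩
  rw [hunion]
  refine isPreconnected_sUnion x₀ c (fun D ⟨γ, hγ, h0, hD⟩ ↦ hD ▸ Or.inl hx₀)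
    (fun D ⟨γ, hγ, h0, hD⟩ ↦ ?_)
  rw [hD]
  have hγc : Continuous γ := continuous_iff_continuousAt.2 fun t ↦ (hγ t).continuousAt
  exact 𝓑.isPreconnected_image_far_aux.union (γ 0) h0 ⟨0, rfl⟩ (isPreconnected_range hγc)

end StationaryAFBlackHole

/-! ### The rest of §3 for the stationary Killing field (Chruściel–Costa 2008, Lemmas 3.2 (1),
3.4–3.7 and Cor. 3.8, case `s = 1`)

With the flow of `X₀` by time-orientation-preserving isometries (`KillingFlowIsometry.lean`) and the
connectedness of `Σ_ext` and `M_ext` (private copies above) the remaining causal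
lemmas of Chruściel–Costa's §3 become available for the stationary Killing field `X₀` alone (their
`K₀ + Σ αᵢ Kᵢ` with `s = 1`; the axisymmetric fields `Kᵢ` are an output of the rigidity theorem and
do not exist in the tree). The statements are phrased flow-free, through the integral curves of
`X₀` (which are the flow lines of any flow of `X₀`, `eq_flow_of_isMIntegralCurve`):

* the (unnumbered) lemma used in the proofs of Lemmas 3.5, 4.1 and Thm. 4.5 — "it follows from
  Lemma [LtorMext] together with asymptotic flatness that there exists `τ` such that
  `φ_τ[K](p₋) ∈ I⁺(p₊)`" — holds here without any asymptotic analysis: **for `p, q ∈ M_ext` the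
  Killing orbit of `q` eventually enters `I⁺(p)`** (`exists_orbit_mem_chronologicalFuture`;
  a connectedness argument on `Σ_ext`);
* **Lemma 3.2 (1)**: a compact `S ⊆ I⁺(M_ext)` lies in `I⁺(p)` for one `p ∈ M_ext`;
* **Lemma 3.5** (with 3.4): the Killing orbits through `⟨⟨M_ext⟩⟩` are future-oriented;
* **Lemma 3.6**: for a flow-invariant `C` meeting `I⁺(M_ext)` (resp. `I⁻(M_ext)`),
  `M_ext ⊆ I⁻(C)` (resp. `M_ext ⊆ I⁺(C)`);
* **Lemma 3.7**: if no point of `⟨⟨M_ext⟩⟩` lies on a closed timelike curve, no non-empty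
  flow-invariant set is contained in a compact subset of `⟨⟨M_ext⟩⟩`;
* **Corollary 3.8**: hence `X₀` has no zeros in `⟨⟨M_ext⟩⟩`; in particular in an `I⁺`-regular
  black hole (`IsIPlusRegular.killing_ne_zero_of_mem_doc`). -/

namespace StationaryAFBlackHole

/-- The regularity bookkeeping used repeatedly below: the stationary Killing field is `C¹` as a
section of `TM`. [folklore] -/
private theorem killing_contMDiff_one (𝓑 : StationaryAFBlackHole.{u}) [𝓑.metric.HasLeviCivita] :
    ContMDiff (𝓡 4) (𝓡 4).tangent 1
      (fun x ↦ (⟨x, 𝓑.killing x⟩ : TangentBundle (𝓡 4) 𝓑.carrier)) :=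
  𝓑.isStationaryKilling.isKillingField.contMDiff.of_le (WithTop.coe_le_coe.mpr le_top)

/-- Along the Killing orbit of a point of `M_ext`, later points are in the chronological future of
earlier ones (the orbit stays in `M_ext`, where `X₀` is future timelike). Chruściel–Costa 2008, §3
("all orbits of a Killing vector `X` are future-oriented in the region where `X` is timelike").
[cite: ChruscielCosta2008, §3 (after Cor. 3.3)] -/
theorem apply_mem_chronologicalFuture_of_mem_Mext {𝓑 : StationaryAFBlackHole.{u}}
    [𝓑.metric.HasLeviCivita] {γ : ℝ → 𝓑.carrier} (hγ : IsMIntegralCurve γ 𝓑.killing)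
    (h0 : γ 0 ∈ 𝓑.Mext) {a b : ℝ} (hab : a < b) :
    γ b ∈ 𝓑.metric.chronologicalFuture 𝓑.timeOrientation {γ a} :=
  LorentzianMetric.apply_mem_chronologicalFuture_of_isMIntegralCurve hγ hab fun t _ ↦
    𝓑.isStationaryKilling.isTimelike (𝓑.Mext_invariant hγ h0 t)

/-- **The Killing orbit of `q ∈ M_ext` eventually enters `I⁺(p)`, for every `p ∈ M_ext`** — and
stays there. This is the property of `M_ext` which Chruściel–Costa use (via "Lemma [LtorMext]
together with asymptotic flatness") in the proofs of Lemma 3.5, Lemma 3.6, Prop. 4.1 and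
Thm. 4.5; in the prelude's rendering `M_ext = ⋃ₜ φₜ(Σ_ext)` with `Σ_ext = embed(e.far (R + 1))`
connected, it holds without asymptotic analysis: the set `U` of points whose orbit meets `I⁺(p)`
is open (continuity of `φ_T`, openness of `I⁺(p)`); a point `y ∈ M_ext ∖ U` has the open
neighbourhood `I⁻(φ₁(y))` disjoint from `U` (if `y' ≪ φ₁(y)` and `φ_T(y') ∈ I⁺(p)` then
`φ_{T+1}(y) ∈ I⁺(φ_T(y')) ⊆ I⁺(p)`, the flow preserving `≪`); `U` contains the point of `Σ_ext` on
the orbit of `p`; so the preconnected `Σ_ext ⊆ U`, and every orbit through `M_ext` passes through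
`Σ_ext`. [cite: ChruscielCosta2008, §3 (proof of Lemma 3.5) and §4.2] -/
theorem exists_orbit_mem_chronologicalFuture {𝓑 : StationaryAFBlackHole.{u}}
    [𝓑.metric.HasLeviCivita] {p q : 𝓑.carrier} (hp : p ∈ 𝓑.Mext) (hq : q ∈ 𝓑.Mext)
    {γ : ℝ → 𝓑.carrier} (hγ : IsMIntegralCurve γ 𝓑.killing) (hγ0 : γ 0 = q) :
    ∃ T : ℝ, ∀ T', T ≤ T' → γ T' ∈ 𝓑.metric.chronologicalFuture 𝓑.timeOrientation {p} := by
  obtain ⟨θ, hθ, hθ0, hθadd, hθX, -⟩ := 𝓑.exists_stationary_flow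
  have hK : 𝓑.metric.IsKillingField 𝓑.killing := 𝓑.isStationaryKilling.isKillingField
  have hK1 := 𝓑.killing_contMDiff_one
  have hθ2 : ContMDiff (𝓘(ℝ, ℝ).prod (𝓡 4)) (𝓡 4) 2 θ := hθ.of_le (WithTop.coe_le_coe.mpr le_top)
  have hMextθ : ∀ y ∈ 𝓑.Mext, ∀ t, θ (t, y) ∈ 𝓑.Mext := fun y hy t ↦
    𝓑.Mext_invariant (hθX y) (by simpa only [hθ0] using hy) t
  -- `U`: the points whose orbit meets `I⁺(p)`
  set U : Set 𝓑.carrier :=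
    {y | ∃ T : ℝ, θ (T, y) ∈ 𝓑.metric.chronologicalFuture 𝓑.timeOrientation {p}} with hU
  have hUopen : IsOpen U := by
    rw [isOpen_iff_mem_nhds]
    rintro y ⟨T, hT⟩
    have hcont : Continuous fun y ↦ θ (T, y) :=
      hθ.continuous.comp (continuous_const.prodMk continuous_id)
    exact Filter.mem_of_superset (hcont.continuousAt.preimage_mem_nhds
      ((LorentzianMetric.isOpen_chronologicalFuture_of_boundaryless 𝓑.metric 𝓑.timeOrientation
        {p}).mem_nhds hT)) fun y' hy' ↦ ⟨T, hy'⟩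
  -- if `y' ≪ φ₁(y)` and the orbit of `y'` meets `I⁺(p)`, so does the orbit of `y`
  have hstep : ∀ y y' : 𝓑.carrier,
      y' ∈ 𝓑.metric.chronologicalPast 𝓑.timeOrientation {θ (1, y)} → y' ∈ U → y ∈ U := by
    rintro y y' hy' ⟨T, hT⟩
    have h1 : θ (1, y) ∈ 𝓑.metric.chronologicalFuture 𝓑.timeOrientation {y'} :=
      LorentzianMetric.mem_chronologicalFuture_of_mem_chronologicalPast hy'
    have h2 : θ (T, θ (1, y)) ∈ 𝓑.metric.chronologicalFuture 𝓑.timeOrientation {θ (T, y')} := by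
      have h := hK.image_flow_chronologicalFuture_subset (τ := 𝓑.timeOrientation) hθ2 hθ0 hθadd
        hθX T {y'} ⟨θ (1, y), h1, rfl⟩
      simpa only [Set.image_singleton] using h
    refine ⟨T + 1, ?_⟩
    rw [← hθadd T 1 y]
    exact LorentzianMetric.mem_chronologicalFuture_trans hT h2
  -- every `y ∈ M_ext` lies in `I⁻(φ₁(y))`
  have hyV : ∀ y ∈ 𝓑.Mext, y ∈ 𝓑.metric.chronologicalPast 𝓑.timeOrientation {θ (1, y)} := by
    intro y hy
    apply LorentzianMetric.mem_chronologicalPast_of_mem_chronologicalFuture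
    have h : θ (1, y) ∈ 𝓑.metric.chronologicalFuture 𝓑.timeOrientation {θ (0, y)} :=
      LorentzianMetric.apply_mem_chronologicalFuture_of_isMIntegralCurve (hθX y)
        zero_lt_one fun t _ ↦ 𝓑.isStationaryKilling.isTimelike (hMextθ y hy t)
    rwa [hθ0] at h
  -- `M_ext ∖ U ⊆ interior Uᶜ`
  have hcompl : ∀ y ∈ 𝓑.Mext, y ∉ U → y ∈ interior Uᶜ := by
    intro y hy hyU
    rw [mem_interior_iff_mem_nhds]
    refine Filter.mem_of_superset ((LorentzianMetric.isOpen_chronologicalPast_of_boundaryless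
      𝓑.metric 𝓑.timeOrientation {θ (1, y)}).mem_nhds (hyV y hy)) fun y' hy' hy'U ↦ ?_
    exact hyU (hstep y y' hy' hy'U)
  -- the point of `Σ_ext` on the orbit of `p` lies in `U`
  obtain ⟨γp, hγp, hγp0, a, rfl⟩ := hp
  have hx₀U : γp 0 ∈ U := by
    refine ⟨a + 1, ?_⟩
    rw [← eq_flow_of_isMIntegralCurve hK1 hθX hθ0 hγp (a + 1)]
    exact apply_mem_chronologicalFuture_of_mem_Mext hγp (𝓑.image_far_subset_Mext hγp0)
      (by linarith)
  -- hence `Σ_ext ⊆ U` (preconnectedness)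
  have hSigmaU : 𝓑.embed '' 𝓑.e.far (𝓑.e.R + 1) ⊆ U := by
    have hsub : 𝓑.embed '' 𝓑.e.far (𝓑.e.R + 1) ⊆ U ∪ interior Uᶜ := fun y hy ↦ by
      by_cases h : y ∈ U
      · exact Or.inl h
      · exact Or.inr (hcompl y (𝓑.image_far_subset_Mext hy) h)
    have hdisj : Disjoint U (interior Uᶜ) := disjoint_compl_right.mono_right interior_subset
    rcases 𝓑.isPreconnected_image_far_aux.subset_or_subset hUopen isOpen_interior hdisj hsub with h | h
    · exact h
    · exact absurd hx₀U (interior_subset (h hγp0))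
  -- the orbit of `q = γq b`, `γq 0 ∈ Σ_ext`
  obtain ⟨γq, hγq, hγq0, b, rfl⟩ := hq
  obtain ⟨T, hT⟩ := hSigmaU hγq0
  refine ⟨T - b, fun T' hT' ↦ ?_⟩
  have hγflow : γ T' = θ (T' + b, γq 0) := by
    rw [eq_flow_of_isMIntegralCurve hK1 hθX hθ0 hγ T', hγ0,
      eq_flow_of_isMIntegralCurve hK1 hθX hθ0 hγq b, hθadd]
  rw [hγflow]
  rcases eq_or_lt_of_le (show T ≤ T' + b by linarith) with h | h
  · rw [← h]
    exact hT
  · exact LorentzianMetric.mem_chronologicalFuture_trans hT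
      (LorentzianMetric.apply_mem_chronologicalFuture_of_isMIntegralCurve (hθX (γq 0)) h
        fun t _ ↦ 𝓑.isStationaryKilling.isTimelike (hMextθ _ (𝓑.image_far_subset_Mext hγq0) t))

/-- **Lemma 3.4** (Chruściel–Costa 2008, case `s = 1`): the Killing orbits through `M_ext` are
future-oriented — for the integral curve `γ` of `X₀` through `q ∈ M_ext`, `γ(τ₁) ∈ I⁺(γ(τ₀))`
whenever `τ₀ < τ₁` ("clearly all orbits of a Killing vector `X` are future-oriented in the region
where `X` is timelike"; the orbit stays in `M_ext`). [cite: ChruscielCosta2008, Lemma 3.4] -/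
theorem apply_mem_chronologicalFuture_of_isMIntegralCurve_of_mem_Mext
    {𝓑 : StationaryAFBlackHole.{u}} [𝓑.metric.HasLeviCivita] {q : 𝓑.carrier} (hq : q ∈ 𝓑.Mext) {γ : ℝ → 𝓑.carrier}
    (hγ : IsMIntegralCurve γ 𝓑.killing) (hγ0 : γ 0 = q) {τ₀ τ₁ : ℝ} (h : τ₀ < τ₁) :
    γ τ₁ ∈ 𝓑.metric.chronologicalFuture 𝓑.timeOrientation {γ τ₀} :=
  apply_mem_chronologicalFuture_of_mem_Mext hγ (hγ0 ▸ hq) h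

/-- **Lemma 3.2 (1)** (Chruściel–Costa 2008): a compact set `S ⊆ I⁺(M_ext)` lies in `I⁺(p)` for
some single `p ∈ M_ext`. Printed proof: cover `S` by finitely many `I⁺(p_{qᵢ})`, `p_{qᵢ} ∈ M_ext`,
and let "`p ∈ M_ext` be any point such that `p_{qᵢ} ∈ I⁺(p)`" — such a common predecessor is
`p = φ₋T(p₀)` for any `p₀ ∈ M_ext` and `T` large, by `exists_orbit_mem_chronologicalFuture`.
[cite: ChruscielCosta2008, Lemma 3.2 (1)] -/
theorem exists_mem_Mext_subset_chronologicalFuture {𝓑 : StationaryAFBlackHole.{u}}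
    [𝓑.metric.HasLeviCivita] {S : Set 𝓑.carrier} (hS : IsCompact S)
    (hSI : S ⊆ 𝓑.metric.chronologicalFuture 𝓑.timeOrientation 𝓑.Mext) :
    ∃ p ∈ 𝓑.Mext, S ⊆ 𝓑.metric.chronologicalFuture 𝓑.timeOrientation {p} := by
  obtain ⟨θ, hθ, hθ0, hθadd, hθX, -⟩ := 𝓑.exists_stationary_flow
  have hK : 𝓑.metric.IsKillingField 𝓑.killing := 𝓑.isStationaryKilling.isKillingField
  have hθ2 : ContMDiff (𝓘(ℝ, ℝ).prod (𝓡 4)) (𝓡 4) 2 θ := hθ.of_le (WithTop.coe_le_coe.mpr le_top)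
  have hcover : S ⊆ ⋃ m ∈ 𝓑.Mext, 𝓑.metric.chronologicalFuture 𝓑.timeOrientation {m} := by
    rw [← LorentzianMetric.chronologicalFuture_eq_biUnion]
    exact hSI
  obtain ⟨F, hFsub, hFfin, hScov⟩ := hS.elim_finite_subcover_image
    (fun m _ ↦ LorentzianMetric.isOpen_chronologicalFuture_of_boundaryless 𝓑.metric
      𝓑.timeOrientation {m}) hcover
  obtain ⟨p₀, hp₀⟩ := 𝓑.Mext_nonempty
  have hT : ∀ m ∈ F, ∃ T : ℝ, ∀ T', T ≤ T' →
      θ (T', m) ∈ 𝓑.metric.chronologicalFuture 𝓑.timeOrientation {p₀} := fun m hm ↦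
    exists_orbit_mem_chronologicalFuture hp₀ (hFsub hm) (hθX m) (hθ0 m)
  choose! Tf hTf using hT
  obtain ⟨T, hTub⟩ := (hFfin.image Tf).bddAbove
  refine ⟨θ (-T, p₀), 𝓑.Mext_invariant (hθX p₀) (by simpa only [hθ0] using hp₀) (-T),
    fun s hs ↦ ?_⟩
  obtain ⟨m, hmF, hsm⟩ := Set.mem_iUnion₂.1 (hScov hs)
  have hm : θ (T, m) ∈ 𝓑.metric.chronologicalFuture 𝓑.timeOrientation {p₀} :=
    hTf m hmF T (hTub ⟨m, hmF, rfl⟩)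
  have h1 : m ∈ 𝓑.metric.chronologicalFuture 𝓑.timeOrientation {θ (-T, p₀)} := by
    have h := hK.image_flow_chronologicalFuture_subset (τ := 𝓑.timeOrientation) hθ2 hθ0 hθadd
      hθX (-T) {p₀} ⟨θ (T, m), hm, flow_neg_apply_flow hθ0 hθadd T m⟩
    simpa only [Set.image_singleton] using h
  exact LorentzianMetric.mem_chronologicalFuture_trans h1 hsm

/-- **Lemma 3.5** (with Lemma 3.4; Chruściel–Costa 2008): **the Killing orbits through
`⟨⟨M_ext⟩⟩` are future-oriented** — for `p ∈ ⟨⟨M_ext⟩⟩` and the integral curve `γ` of `X₀` through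
`p` there is `τ > 0` with `γ(τ) ∈ I⁺(p)`. Printed proof: `p₋ ≪ p ≪ p₊` with `p_± ∈ M_ext`; choose
`τ` with `φ_τ(p₋) ∈ I⁺(p₊)` (`exists_orbit_mem_chronologicalFuture`); then
`p ≪ p₊ ≪ φ_τ(p₋) ≪ φ_τ(p)`, the last step by applying the `≪`-preserving `φ_τ` to `p₋ ≪ p`.
[cite: ChruscielCosta2008, Lemma 3.5] -/
theorem exists_pos_apply_mem_chronologicalFuture_of_mem_doc {𝓑 : StationaryAFBlackHole.{u}}
    [𝓑.metric.HasLeviCivita] {p : 𝓑.carrier} (hp : p ∈ 𝓑.doc) {γ : ℝ → 𝓑.carrier}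
    (hγ : IsMIntegralCurve γ 𝓑.killing) (hγ0 : γ 0 = p) :
    ∃ τ : ℝ, 0 < τ ∧ γ τ ∈ 𝓑.metric.chronologicalFuture 𝓑.timeOrientation {p} := by
  obtain ⟨θ, hθ, hθ0, hθadd, hθX, -⟩ := 𝓑.exists_stationary_flow
  have hK : 𝓑.metric.IsKillingField 𝓑.killing := 𝓑.isStationaryKilling.isKillingField
  have hK1 := 𝓑.killing_contMDiff_one
  have hθ2 : ContMDiff (𝓘(ℝ, ℝ).prod (𝓡 4)) (𝓡 4) 2 θ := hθ.of_le (WithTop.coe_le_coe.mpr le_top)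
  obtain ⟨pm, hpm, hrestm⟩ := hp.1
  have hppm : p ∈ 𝓑.metric.chronologicalFuture 𝓑.timeOrientation {pm} := ⟨pm, rfl, hrestm⟩
  obtain ⟨pp, hpp0, hrestp⟩ := hp.2
  have hppp : pp ∈ 𝓑.metric.chronologicalFuture 𝓑.timeOrientation {p} :=
    LorentzianMetric.mem_chronologicalFuture_of_mem_chronologicalPast ⟨pp, rfl, hrestp⟩
  obtain ⟨T, hT⟩ := exists_orbit_mem_chronologicalFuture hpp0 hpm (hθX pm) (hθ0 pm)
  obtain ⟨τ, hTτ, h1τ⟩ : ∃ τ : ℝ, T ≤ τ ∧ 1 ≤ τ := ⟨max T 1, le_max_left _ _, le_max_right _ _⟩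
  have hτp : θ (τ, pm) ∈ 𝓑.metric.chronologicalFuture 𝓑.timeOrientation {pp} := hT τ hTτ
  have h2 : θ (τ, p) ∈ 𝓑.metric.chronologicalFuture 𝓑.timeOrientation {θ (τ, pm)} := by
    have h := hK.image_flow_chronologicalFuture_subset (τ := 𝓑.timeOrientation) hθ2 hθ0 hθadd hθX
      τ {pm} ⟨p, hppm, rfl⟩
    simpa only [Set.image_singleton] using h
  refine ⟨τ, lt_of_lt_of_le one_pos h1τ, ?_⟩
  rw [eq_flow_of_isMIntegralCurve hK1 hθX hθ0 hγ τ, hγ0]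
  exact LorentzianMetric.mem_chronologicalFuture_trans
    (LorentzianMetric.mem_chronologicalFuture_trans hppp hτp) h2

/-- **Every Killing orbit through `⟨⟨M_ext⟩⟩` meets the past of `Σ_ext`** (first step of the proof
of the structure theorem, Chruściel–Costa 2008, §4.2, Thm. 4.5: "for any `q` in `⟨⟨M_ext⟩⟩` there
exist points `p_± ∈ M_ext` such that `q ∈ I^∓(p_±)`. Since the flow of `K₀` in `M_ext` is by time
translations there exist `t_±` so that `φ_{t_±}(p_±) ∈ Σ_ext`. Hence `φ_{t_±}(q) ∈ I^∓(Σ_ext)`"):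
for `q ∈ ⟨⟨M_ext⟩⟩` and the integral curve `γ` of `X₀` through `q`, some `γ(t₊)` lies in `I⁻(Σ_ext)`
(apply the `≪`-preserving flow map `φ₋ₐ` to `q ≪ p₊ = φₐ(x)`, `x ∈ Σ_ext`). [cite: ChruscielCosta2008, §4.2 (proof of Thm. 4.5)] -/
theorem exists_apply_mem_chronologicalPast_image_far_of_mem_doc {𝓑 : StationaryAFBlackHole.{u}}
    [𝓑.metric.HasLeviCivita] {q : 𝓑.carrier} (hq : q ∈ 𝓑.doc) {γ : ℝ → 𝓑.carrier}
    (hγ : IsMIntegralCurve γ 𝓑.killing) (hγ0 : γ 0 = q) :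
    ∃ t : ℝ, γ t ∈ 𝓑.metric.chronologicalPast 𝓑.timeOrientation
      (𝓑.embed '' 𝓑.e.far (𝓑.e.R + 1)) := by
  obtain ⟨θ, hθ, hθ0, hθadd, hθX, -⟩ := 𝓑.exists_stationary_flow
  have hK : 𝓑.metric.IsKillingField 𝓑.killing := 𝓑.isStationaryKilling.isKillingField
  have hK1 := 𝓑.killing_contMDiff_one
  have hθ2 : ContMDiff (𝓘(ℝ, ℝ).prod (𝓡 4)) (𝓡 4) 2 θ := hθ.of_le (WithTop.coe_le_coe.mpr le_top)
  -- `q ≪ p₊ = γpl a`, `γpl 0 ∈ Σ_ext`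
  obtain ⟨_, ⟨γpl, hγp', hγp0', a, rfl⟩, hrest⟩ := hq.2
  have hqp : q ∈ 𝓑.metric.chronologicalPast 𝓑.timeOrientation {γpl a} := ⟨γpl a, rfl, hrest⟩
  refine ⟨-a, ?_⟩
  -- `φ₋ₐ(q) ≪ φ₋ₐ(γ₊ a) = γ₊ 0`
  have h := hK.image_flow_chronologicalPast (τ := 𝓑.timeOrientation) hθ2 hθ0 hθadd hθX (-a) {γpl a}
  have hmem : θ (-a, q) ∈ (fun p ↦ θ (-a, p)) '' 𝓑.metric.chronologicalPast 𝓑.timeOrientation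
      {γpl a} := Set.mem_image_of_mem _ hqp
  rw [h] at hmem
  simp only [Set.image_singleton] at hmem
  have hflow : θ (-a, γpl a) = γpl 0 := by
    rw [eq_flow_of_isMIntegralCurve hK1 hθX hθ0 hγp' a, flow_neg_apply_flow hθ0 hθadd]
  rw [hflow] at hmem
  rw [eq_flow_of_isMIntegralCurve hK1 hθX hθ0 hγ (-a), hγ0]
  exact LorentzianMetric.chronologicalPast_mono (Set.singleton_subset_iff.2 hγp0') hmem

/-- **Every Killing orbit through `⟨⟨M_ext⟩⟩` meets the future of `Σ_ext`** (time dual of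
`exists_apply_mem_chronologicalPast_image_far_of_mem_doc`). Chruściel–Costa 2008, §4.2 (proof of
Thm. 4.5). [cite: ChruscielCosta2008, §4.2 (proof of Thm. 4.5)] -/
theorem exists_apply_mem_chronologicalFuture_image_far_of_mem_doc {𝓑 : StationaryAFBlackHole.{u}}
    [𝓑.metric.HasLeviCivita] {q : 𝓑.carrier} (hq : q ∈ 𝓑.doc) {γ : ℝ → 𝓑.carrier}
    (hγ : IsMIntegralCurve γ 𝓑.killing) (hγ0 : γ 0 = q) :
    ∃ t : ℝ, γ t ∈ 𝓑.metric.chronologicalFuture 𝓑.timeOrientation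
      (𝓑.embed '' 𝓑.e.far (𝓑.e.R + 1)) := by
  obtain ⟨θ, hθ, hθ0, hθadd, hθX, -⟩ := 𝓑.exists_stationary_flow
  have hK : 𝓑.metric.IsKillingField 𝓑.killing := 𝓑.isStationaryKilling.isKillingField
  have hK1 := 𝓑.killing_contMDiff_one
  have hθ2 : ContMDiff (𝓘(ℝ, ℝ).prod (𝓡 4)) (𝓡 4) 2 θ := hθ.of_le (WithTop.coe_le_coe.mpr le_top)
  obtain ⟨_, ⟨γmi, hγm', hγm0, a, rfl⟩, hrest⟩ := hq.1
  have hqp : q ∈ 𝓑.metric.chronologicalFuture 𝓑.timeOrientation {γmi a} := ⟨γmi a, rfl, hrest⟩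
  refine ⟨-a, ?_⟩
  have h := hK.image_flow_chronologicalFuture (τ := 𝓑.timeOrientation) hθ2 hθ0 hθadd hθX (-a) {γmi a}
  have hmem : θ (-a, q) ∈ (fun p ↦ θ (-a, p)) '' 𝓑.metric.chronologicalFuture 𝓑.timeOrientation
      {γmi a} := Set.mem_image_of_mem _ hqp
  rw [h] at hmem
  simp only [Set.image_singleton] at hmem
  have hflow : θ (-a, γmi a) = γmi 0 := by
    rw [eq_flow_of_isMIntegralCurve hK1 hθX hθ0 hγm' a, flow_neg_apply_flow hθ0 hθadd]
  rw [hflow] at hmem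
  rw [eq_flow_of_isMIntegralCurve hK1 hθX hθ0 hγ (-a), hγ0]
  exact LorentzianMetric.chronologicalFuture_mono (Set.singleton_subset_iff.2 hγm0) hmem

/-- In particular every Killing orbit through `⟨⟨M_ext⟩⟩` meets both the chronological past and the
chronological future of the hypersurface `S ⊇ Σ_ext` of Def. 1.1 ("every orbit of `K₀` meets both
the future and the past of `S`", Chruściel–Costa 2008, §4.2, proof of Thm. 4.5; that it then meets
`S` itself uses the partition `⟨⟨M_ext⟩⟩ = I⁺(S) ∪ S ∪ I⁻(S)`, not proved here). [cite: ChruscielCosta2008, §4.2 (proof of Thm. 4.5)] -/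
theorem IPlusRegularHypersurface.exists_apply_mem_chronologicalPast_and_Future
    {𝓑 : StationaryAFBlackHole.{u}} [𝓑.metric.HasLeviCivita] (𝒮 : 𝓑.IPlusRegularHypersurface)
    {q : 𝓑.carrier} (hq : q ∈ 𝓑.doc) {γ : ℝ → 𝓑.carrier} (hγ : IsMIntegralCurve γ 𝓑.killing)
    (hγ0 : γ 0 = q) :
    (∃ t : ℝ, γ t ∈ 𝓑.metric.chronologicalPast 𝓑.timeOrientation 𝒮.carrierSet) ∧
      ∃ t : ℝ, γ t ∈ 𝓑.metric.chronologicalFuture 𝓑.timeOrientation 𝒮.carrierSet := by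
  constructor
  · obtain ⟨t, ht⟩ := exists_apply_mem_chronologicalPast_image_far_of_mem_doc hq hγ hγ0
    exact ⟨t, LorentzianMetric.chronologicalPast_mono 𝒮.image_far_subset_range ht⟩
  · obtain ⟨t, ht⟩ := exists_apply_mem_chronologicalFuture_image_far_of_mem_doc hq hγ hγ0
    exact ⟨t, LorentzianMetric.chronologicalFuture_mono 𝒮.image_far_subset_range ht⟩

/-- A set invariant under the integral curves of `X₀` is invariant under every flow map of `X₀`
(as an equality of sets). [folklore] -/
private theorem image_flow_eq_of_invariant {𝓑 : StationaryAFBlackHole.{u}}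
    {θ : ℝ × 𝓑.carrier → 𝓑.carrier}
    (hθ0 : ∀ p, θ (0, p) = p) (hθadd : ∀ t s p, θ (t, θ (s, p)) = θ (t + s, p))
    (hθX : ∀ p, IsMIntegralCurve (fun t ↦ θ (t, p)) 𝓑.killing) {C : Set 𝓑.carrier}
    (hC : ∀ γ : ℝ → 𝓑.carrier, IsMIntegralCurve γ 𝓑.killing → γ 0 ∈ C → ∀ t, γ t ∈ C) (t : ℝ) :
    (fun q ↦ θ (t, q)) '' C = C := by
  ext c
  constructor
  · rintro ⟨c', hc', rfl⟩
    exact hC _ (hθX c') (by simpa only [hθ0] using hc') t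
  · intro hc
    exact ⟨θ (-t, c), hC _ (hθX c) (by simpa only [hθ0] using hc) (-t),
      flow_apply_flow_neg hθ0 hθadd t c⟩

/-- **Lemma 3.6** (Chruściel–Costa 2008, essentially Chruściel–Wald), past form: if `C` is
invariant under the flow of `X₀` (every integral curve of `X₀` starting in `C` stays in `C`) and
`C` meets `I⁺(M_ext)`, then `M_ext ⊆ I⁻(C)`. Printed proof: the achronal boundary `İ⁻(C)` is
flow-invariant (the flow commutes with `I⁻` and is a homeomorphism), hence cannot meet `M_ext`,
along which the orbits are timelike (a point of `İ⁻(C) ∩ M_ext` and its translate `φ₁` of it would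
be two chronologically related points of an achronal set); so the connected `M_ext` lies in
`I⁻(C)` or in `M ∖ cl I⁻(C)`, and the former holds as soon as `I⁻(C) ∩ M_ext ≠ ∅`, i.e. as soon as
`C ∩ I⁺(M_ext) ≠ ∅`. [cite: ChruscielCosta2008, Lemma 3.6] -/
theorem Mext_subset_chronologicalPast_of_invariant {𝓑 : StationaryAFBlackHole.{u}}
    [𝓑.metric.HasLeviCivita] {C : Set 𝓑.carrier}
    (hC : ∀ γ : ℝ → 𝓑.carrier, IsMIntegralCurve γ 𝓑.killing → γ 0 ∈ C → ∀ t, γ t ∈ C)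
    (hne : (C ∩ 𝓑.metric.chronologicalFuture 𝓑.timeOrientation 𝓑.Mext).Nonempty) :
    𝓑.Mext ⊆ 𝓑.metric.chronologicalPast 𝓑.timeOrientation C := by
  obtain ⟨θ, hθ, hθ0, hθadd, hθX, -⟩ := 𝓑.exists_stationary_flow
  have hK : 𝓑.metric.IsKillingField 𝓑.killing := 𝓑.isStationaryKilling.isKillingField
  have hθ2 : ContMDiff (𝓘(ℝ, ℝ).prod (𝓡 4)) (𝓡 4) 2 θ := hθ.of_le (WithTop.coe_le_coe.mpr le_top)
  set W : Set 𝓑.carrier := 𝓑.metric.chronologicalPast 𝓑.timeOrientation C with hW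
  have hWopen : IsOpen W :=
    LorentzianMetric.isOpen_chronologicalPast_of_boundaryless 𝓑.metric 𝓑.timeOrientation C
  have hWimg : ∀ t, (fun q ↦ θ (t, q)) '' W = W := fun t ↦ by
    rw [hW, hK.image_flow_chronologicalPast hθ2 hθ0 hθadd hθX t C,
      image_flow_eq_of_invariant hθ0 hθadd hθX hC t]
  have hfr : ∀ t, (fun q ↦ θ (t, q)) '' frontier W = frontier W := fun t ↦ by
    rw [(isHomeomorph_flow hθ.continuous hθ0 hθadd t).image_frontier, hWimg t]
  -- `M_ext ∩ ∂W = ∅`: `∂W` is achronal and flow-invariant, the orbits in `M_ext` are timelike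
  have hdisj : ∀ a ∈ 𝓑.Mext, a ∉ frontier W := by
    intro a ha hfa
    have h1 : θ (1, a) ∈ frontier W := by
      rw [← hfr 1]
      exact Set.mem_image_of_mem _ hfa
    have h2 : θ (1, a) ∈ 𝓑.metric.chronologicalFuture 𝓑.timeOrientation {a} := by
      have h : θ (1, a) ∈ 𝓑.metric.chronologicalFuture 𝓑.timeOrientation {θ (0, a)} :=
        LorentzianMetric.apply_mem_chronologicalFuture_of_isMIntegralCurve (hθX a)
          zero_lt_one fun t _ ↦ 𝓑.isStationaryKilling.isTimelike
            (𝓑.Mext_invariant (hθX a) (by simpa only [hθ0] using ha) t)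
      rwa [hθ0] at h
    exact (LorentzianMetric.isPastSet_chronologicalPast C).isAchronal_frontier a hfa (θ (1, a))
      h1 h2
  have hsub : 𝓑.Mext ⊆ W ∪ (closure W)ᶜ := by
    intro a ha
    by_cases haW : a ∈ closure W
    · left
      by_contra h
      exact hdisj a ha ⟨haW, by rwa [hWopen.interior_eq]⟩
    · exact Or.inr haW
  have hdis : Disjoint W (closure W)ᶜ := disjoint_compl_right.mono_left subset_closure
  rcases 𝓑.isPreconnected_Mext_aux.subset_or_subset hWopen isClosed_closure.isOpen_compl
    hdis hsub with h | h
  · exact h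
  · exfalso
    obtain ⟨c, hcC, m, hm, hrest⟩ := hne
    have hmW : m ∈ W := LorentzianMetric.chronologicalPast_mono (Set.singleton_subset_iff.2 hcC)
      (LorentzianMetric.mem_chronologicalPast_of_mem_chronologicalFuture
        (⟨m, rfl, hrest⟩ : c ∈ 𝓑.metric.chronologicalFuture 𝓑.timeOrientation {m}))
    exact h hm (subset_closure hmW)

/-- `I⁺(C)` is a future set: `I⁺(I⁺(C)) ⊆ I⁺(C)`. Hawking–Ellis 1973, §6.3. [cite: HawkingEllis1973, §6.3, p. 186] -/
private theorem isFutureSet_chronologicalFuture' {𝓑 : StationaryAFBlackHole.{u}}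
    (C : Set 𝓑.carrier) :
    𝓑.metric.IsFutureSet 𝓑.timeOrientation (𝓑.metric.chronologicalFuture 𝓑.timeOrientation C) :=
  fun _ ⟨q, hq, h⟩ ↦ LorentzianMetric.mem_chronologicalFuture_trans hq ⟨q, rfl, h⟩

/-- **Lemma 3.6**, future form: if `C` is invariant under the flow of `X₀` and meets `I⁻(M_ext)`,
then `M_ext ⊆ I⁺(C)`. Chruściel–Costa 2008, Lemma 3.6 ("a similar argument applies if `C`
intersects `I⁻(M_ext)`"). [cite: ChruscielCosta2008, Lemma 3.6] -/
theorem Mext_subset_chronologicalFuture_of_invariant {𝓑 : StationaryAFBlackHole.{u}}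
    [𝓑.metric.HasLeviCivita] {C : Set 𝓑.carrier}
    (hC : ∀ γ : ℝ → 𝓑.carrier, IsMIntegralCurve γ 𝓑.killing → γ 0 ∈ C → ∀ t, γ t ∈ C)
    (hne : (C ∩ 𝓑.metric.chronologicalPast 𝓑.timeOrientation 𝓑.Mext).Nonempty) :
    𝓑.Mext ⊆ 𝓑.metric.chronologicalFuture 𝓑.timeOrientation C := by
  obtain ⟨θ, hθ, hθ0, hθadd, hθX, -⟩ := 𝓑.exists_stationary_flow
  have hK : 𝓑.metric.IsKillingField 𝓑.killing := 𝓑.isStationaryKilling.isKillingField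
  have hθ2 : ContMDiff (𝓘(ℝ, ℝ).prod (𝓡 4)) (𝓡 4) 2 θ := hθ.of_le (WithTop.coe_le_coe.mpr le_top)
  set W : Set 𝓑.carrier := 𝓑.metric.chronologicalFuture 𝓑.timeOrientation C with hW
  have hWopen : IsOpen W :=
    LorentzianMetric.isOpen_chronologicalFuture_of_boundaryless 𝓑.metric 𝓑.timeOrientation C
  have hWimg : ∀ t, (fun q ↦ θ (t, q)) '' W = W := fun t ↦ by
    rw [hW, hK.image_flow_chronologicalFuture hθ2 hθ0 hθadd hθX t C,
      image_flow_eq_of_invariant hθ0 hθadd hθX hC t]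
  have hfr : ∀ t, (fun q ↦ θ (t, q)) '' frontier W = frontier W := fun t ↦ by
    rw [(isHomeomorph_flow hθ.continuous hθ0 hθadd t).image_frontier, hWimg t]
  have hdisj : ∀ a ∈ 𝓑.Mext, a ∉ frontier W := by
    intro a ha hfa
    have h1 : θ (1, a) ∈ frontier W := by
      rw [← hfr 1]
      exact Set.mem_image_of_mem _ hfa
    have h2 : θ (1, a) ∈ 𝓑.metric.chronologicalFuture 𝓑.timeOrientation {a} := by
      have h : θ (1, a) ∈ 𝓑.metric.chronologicalFuture 𝓑.timeOrientation {θ (0, a)} :=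
        LorentzianMetric.apply_mem_chronologicalFuture_of_isMIntegralCurve (hθX a)
          zero_lt_one fun t _ ↦ 𝓑.isStationaryKilling.isTimelike
            (𝓑.Mext_invariant (hθX a) (by simpa only [hθ0] using ha) t)
      rwa [hθ0] at h
    exact (isFutureSet_chronologicalFuture' C).isAchronal_frontier a hfa (θ (1, a)) h1 h2
  have hsub : 𝓑.Mext ⊆ W ∪ (closure W)ᶜ := by
    intro a ha
    by_cases haW : a ∈ closure W
    · left
      by_contra h
      exact hdisj a ha ⟨haW, by rwa [hWopen.interior_eq]⟩
    · exact Or.inr haW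
  have hdis : Disjoint W (closure W)ᶜ := disjoint_compl_right.mono_left subset_closure
  rcases 𝓑.isPreconnected_Mext_aux.subset_or_subset hWopen isClosed_closure.isOpen_compl
    hdis hsub with h | h
  · exact h
  · exfalso
    obtain ⟨c, hcC, m, hm, hrest⟩ := hne
    have hmW : m ∈ W := LorentzianMetric.chronologicalFuture_mono (Set.singleton_subset_iff.2 hcC)
      (LorentzianMetric.mem_chronologicalFuture_of_mem_chronologicalPast
        (⟨m, rfl, hrest⟩ : c ∈ 𝓑.metric.chronologicalPast 𝓑.timeOrientation {m}))
    exact h hm (subset_closure hmW)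

/-- **Lemma 3.7** (Chruściel–Costa 2008, case `s = 1`): if no point of `⟨⟨M_ext⟩⟩` lies on a closed
timelike curve, then no non-empty set `N` invariant under the flow of `X₀` is contained in a
compact subset `C` of `⟨⟨M_ext⟩⟩`. Printed proof: by Lemma 3.6, `M_ext ⊆ I⁺(N) ∩ I⁻(N)`, hence
`⟨⟨M_ext⟩⟩ ⊆ I⁺(N)`; `{I⁺(p) ∩ C}_{p ∈ N}` is an open cover of `C` with a finite subcover
`I⁺(p₁), …, I⁺(p_I)`; "each `pᵢ` must be in the future of at least one `pⱼ`, and since there is a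
finite number of them one eventually gets a closed timelike curve" (iterate the choice and apply
the pigeonhole principle). [cite: ChruscielCosta2008, Lemma 3.7] -/
theorem not_nonempty_invariant_subset_compact {𝓑 : StationaryAFBlackHole.{u}}
    [𝓑.metric.HasLeviCivita]
    (hchr : ∀ p ∈ 𝓑.doc, p ∉ 𝓑.metric.chronologicalFuture 𝓑.timeOrientation {p})
    {N C : Set 𝓑.carrier} (hNC : N ⊆ C) (hCdoc : C ⊆ 𝓑.doc) (hCc : IsCompact C)
    (hN : ∀ γ : ℝ → 𝓑.carrier, IsMIntegralCurve γ 𝓑.killing → γ 0 ∈ N → ∀ t, γ t ∈ N)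
    (hne : N.Nonempty) : False := by
  obtain ⟨n₀, hn₀⟩ := hne
  have h2 : 𝓑.Mext ⊆ 𝓑.metric.chronologicalFuture 𝓑.timeOrientation N :=
    Mext_subset_chronologicalFuture_of_invariant hN ⟨n₀, hn₀, (hCdoc (hNC hn₀)).2⟩
  have hdocN : 𝓑.doc ⊆ 𝓑.metric.chronologicalFuture 𝓑.timeOrientation N := fun x hx ↦ by
    obtain ⟨m, hm, hrest⟩ := hx.1
    exact LorentzianMetric.mem_chronologicalFuture_trans (h2 hm) ⟨m, rfl, hrest⟩
  have hcov : C ⊆ ⋃ n ∈ N, 𝓑.metric.chronologicalFuture 𝓑.timeOrientation {n} := by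
    rw [← LorentzianMetric.chronologicalFuture_eq_biUnion]
    exact hCdoc.trans hdocN
  obtain ⟨F, hFN, hFfin, hCF⟩ := hCc.elim_finite_subcover_image
    (fun n _ ↦ LorentzianMetric.isOpen_chronologicalFuture_of_boundaryless 𝓑.metric
      𝓑.timeOrientation {n}) hcov
  have hσ : ∀ c ∈ C, ∃ n ∈ F, c ∈ 𝓑.metric.chronologicalFuture 𝓑.timeOrientation {n} :=
    fun c hc ↦ by simpa only [Set.mem_iUnion, exists_prop] using hCF hc
  haveI : Nonempty 𝓑.carrier := ⟨n₀⟩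
  choose! σ hσF hσI using hσ
  -- iterate the choice function, starting from `n₀ ∈ N ⊆ C`
  have hFC : F ⊆ C := hFN.trans hNC
  have hqC : ∀ k : ℕ, σ^[k] n₀ ∈ C := by
    intro k
    induction k with
    | zero => exact hNC hn₀
    | succ k ih =>
      rw [Function.iterate_succ_apply']
      exact hFC (hσF _ ih)
  have hqF : ∀ k : ℕ, σ^[k + 1] n₀ ∈ F := fun k ↦ by
    rw [Function.iterate_succ_apply']
    exact hσF _ (hqC k)
  have hqI : ∀ k : ℕ,
      σ^[k] n₀ ∈ 𝓑.metric.chronologicalFuture 𝓑.timeOrientation {σ^[k + 1] n₀} := fun k ↦ by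
    rw [Function.iterate_succ_apply']
    exact hσI _ (hqC k)
  -- `σ^[i] n₀ ∈ I⁺(σ^[j] n₀)` for `i < j`
  have hchain : ∀ i j : ℕ, i < j →
      σ^[i] n₀ ∈ 𝓑.metric.chronologicalFuture 𝓑.timeOrientation {σ^[j] n₀} := by
    intro i j hij
    induction hij with
    | refl => exact hqI i
    | step hle ih => exact LorentzianMetric.mem_chronologicalFuture_trans (hqI _) ih
  -- pigeonhole on the finite set `F`
  haveI : Finite F := hFfin.to_subtype
  obtain ⟨i, j, hne', heq⟩ :=
    Finite.exists_ne_map_eq_of_infinite (fun k : ℕ ↦ (⟨σ^[k + 1] n₀, hqF k⟩ : F))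
  have heq' : σ^[i + 1] n₀ = σ^[j + 1] n₀ := congrArg Subtype.val heq
  rcases lt_or_gt_of_ne hne' with h | h
  · have hc := hchain (i + 1) (j + 1) (by omega)
    rw [heq'] at hc
    exact hchr _ (hCdoc (hqC (j + 1))) hc
  · have hc := hchain (j + 1) (i + 1) (by omega)
    rw [← heq'] at hc
    exact hchr _ (hCdoc (hqC (i + 1))) hc

/-- **Corollary 3.8** (Chruściel–Costa 2008, `s = 1`): if no point of `⟨⟨M_ext⟩⟩` lies on a closed
timelike curve (e.g. if `⟨⟨M_ext⟩⟩` is chronological, or strongly causal as in an `I⁺`-regular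
black hole), **the stationary Killing field has no zeros in `⟨⟨M_ext⟩⟩`**: a zero is a compact
flow-invariant set (Lemma 3.7). [cite: ChruscielCosta2008, Cor. 3.8] -/
theorem killing_ne_zero_of_mem_doc {𝓑 : StationaryAFBlackHole.{u}} [𝓑.metric.HasLeviCivita]
    (hchr : ∀ p ∈ 𝓑.doc, p ∉ 𝓑.metric.chronologicalFuture 𝓑.timeOrientation {p})
    {x : 𝓑.carrier} (hx : x ∈ 𝓑.doc) : 𝓑.killing x ≠ 0 := by
  intro h0
  refine not_nonempty_invariant_subset_compact hchr (subset_refl {x})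
    (Set.singleton_subset_iff.2 hx) isCompact_singleton ?_ (Set.singleton_nonempty x)
  intro γ hγ hγ0 t
  rw [Set.mem_singleton_iff] at hγ0 ⊢
  have h := isMIntegralCurve_Ioo_eq_of_contMDiff_boundaryless (t₀ := 0) 𝓑.killing_contMDiff_one hγ
    (isMIntegralCurve_const h0) (by simpa using hγ0)
  exact congrFun h t

/-- In an `I⁺`-regular black hole no point of `⟨⟨M_ext⟩⟩` lies on a closed timelike curve (strong
causality holds on the globally hyperbolic set `⟨⟨M_ext⟩⟩`). Chruściel–Costa 2008, Def. 1.1 with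
Hawking–Ellis 1973, §6.4–§6.6. [cite: ChruscielCosta2008, Def. 1.1] -/
theorem IsIPlusRegular.not_mem_chronologicalFuture_self {𝓑 : StationaryAFBlackHole.{u}}
    (h : 𝓑.IsIPlusRegular) {p : 𝓑.carrier} (hp : p ∈ 𝓑.doc) :
    p ∉ 𝓑.metric.chronologicalFuture 𝓑.timeOrientation {p} := by
  rintro ⟨p', hp', γ, a, b, hab, hγ, hpa, hpb⟩
  rw [Set.mem_singleton_iff] at hp'
  exact (h.isStronglyCausalAt hp).apply_ne_of_isFutureCausalCurveOn hab hγ.isFutureCausalCurveOn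
    (hpa.trans hp') hpb

/-- **Corollary 3.8, `I⁺`-regular form**: the stationary Killing field of an `I⁺`-regular black hole
has no zeros in the domain of outer communications. Chruściel–Costa 2008, Cor. 3.8. [cite: ChruscielCosta2008, Cor. 3.8] -/
theorem IsIPlusRegular.killing_ne_zero_of_mem_doc {𝓑 : StationaryAFBlackHole.{u}}
    [𝓑.metric.HasLeviCivita] (h : 𝓑.IsIPlusRegular) {x : 𝓑.carrier} (hx : x ∈ 𝓑.doc) :
    𝓑.killing x ≠ 0 :=
  StationaryAFBlackHole.killing_ne_zero_of_mem_doc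
    (fun _ hp ↦ h.not_mem_chronologicalFuture_self hp) hx

/-- **Lemma 3.7, `I⁺`-regular form**: in an `I⁺`-regular black hole no non-empty flow-invariant set
lies in a compact subset of `⟨⟨M_ext⟩⟩` (so, e.g., no Killing orbit through `⟨⟨M_ext⟩⟩` has compact
closure in `⟨⟨M_ext⟩⟩`). Chruściel–Costa 2008, Lemma 3.7. [cite: ChruscielCosta2008, Lemma 3.7] -/
theorem IsIPlusRegular.not_nonempty_invariant_subset_compact {𝓑 : StationaryAFBlackHole.{u}}
    [𝓑.metric.HasLeviCivita] (h : 𝓑.IsIPlusRegular) {N C : Set 𝓑.carrier} (hNC : N ⊆ C)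
    (hCdoc : C ⊆ 𝓑.doc) (hCc : IsCompact C)
    (hN : ∀ γ : ℝ → 𝓑.carrier, IsMIntegralCurve γ 𝓑.killing → γ 0 ∈ N → ∀ t, γ t ∈ N)
    (hne : N.Nonempty) : False :=
  StationaryAFBlackHole.not_nonempty_invariant_subset_compact
    (fun _ hp ↦ h.not_mem_chronologicalFuture_self hp) hNC hCdoc hCc hN hne

end StationaryAFBlackHole

end Literature.Geometry.Lorentzian

end
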